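import Summits.QuantumFields.YangMills.Theorems.UnitScaleTiltProp7LODAssemblyMemberClosed
import Summits.QuantumFields.YangMills.Theorems.UnitScaleTiltProp7LODTargetAllMembers
import Summits.QuantumFields.YangMills.Theorems.UnitScaleTiltProp7MassivePropagatorCoercive
import Summits.QuantumFields.YangMills.Theorems.UnitScaleTiltProp7LocalProjectorRowsRBOfCube
import Summits.QuantumFields.YangMills.Theorems.UnitScaleTiltProp7GramNearRowOfCube
import Summits.QuantumFields.YangMills.Theorems.UnitScaleTiltProp7LODSlotK2WindowLetters
import Summits.QuantumFields.YangMills.Theorems.UnitScaleTiltProp7LocalProjectorRowCubeWindow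
import HarnessLib

/-!
# (L6) THE LOD TARGET AT ONE LARGE MEMBER, CLOSED DOWN TO NUMERIC LETTERS (Bałaban CMP 102 §3, Prop. 7 ⇒ Thm 1's curved-target row)

The assembler's knit of the 19200 LOD line (px10 g11), one large member `(F, n < K, h)` of the printed carrier:

* §1 `exists_cube_families` — the massive families OF RECORD over the coarse space of weight `c₁`: the intertwiner `ι` (★p1's embedding,
  `hι` by `rfl`), per unit cube `c` the transported constraint `Qc c` of px17's ✓`exists_intertwiner_of_regPr` at the re-based window field,
  `Tc c := (ι ∘ Qc c)†`, the massive inverse `Gc c` of routeR-w2's ✓`exists_massive_inverse`, and the flat pair `(T1, G1)` at `U₀ = 1`;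
  `hwrapRb_of_room` — the no-wrap room `2((Rb+9)·L^{K−n} + 2) ≤ sitesPerDir` from `Rb + 11 ≤ L^{m+n}`.
* §2 (D1) `hRB1_of_cube_le` · `hRB2_of_cube_le` · `hop_of_cube_le` — routeR-w3 g13's three per-cube rows (✓p761882 STAGE RB, ✓p762279 STAGE OP)
  with their printed constants bounded by letters `cG cQ εN`.
* §3 (D2) ★★★ `curvedTarget_member_numeric` — ✓p761358 `curvedTarget_member_of_cubeRows` ⊕ §1 ⊕ §2 ⊕ routeR-w4 g27's ✓`window_delta` and
  ✓`deltaPmax_le_of_budget`: the curved-target row at the member with ONLY numeric letters displayed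
  (`θ θc κP δP am a₀ ε₀ s r ν μa Bt Bc Rb cG cQ εN c₁`), every operator family chosen inside the proof.

CONDITIONAL in the sense of the line: the coefficient is not asserted positive here (the grand window (D3) and the `∃`-packaged `hT` (D4) follow).
No `def`, no `sorry`; default heartbeats except the decl-local `maxHeartbeats 400000` on §3 (its 57-binder statement elaborates at ≈ 190k,
inside the cell's 160–200k cliff — px12 g15 05:38Z flag; budget line per the README rule).

References: T. Bałaban, *Propagators for lattice gauge theories in a background field*, CMP 99 (1985) 389–434, (3.20)–(3.27) pp.394–395, (3.49) p.399,
(3.100) pp.413–414, Thm 3.11 p.416 [cite: Balaban1985BackgroundPropagators]; T. Bałaban, *Propagators and renormalization transformations I*,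
CMP 95 (1984) 17–40, Prop. 1.1 (1.90) p.33 [cite: Balaban1984PropagatorsI].
-/

set_option autoImplicit false

noncomputable section

open scoped InnerProductSpace ComplexConjugate Matrix.Norms.L2Operator BigOperators

namespace Summit.QuantumFields.YangMills.Theorems.Prop7LODTargetClosed

open Literature.MathematicalPhysics.QuantumFieldTheory.Balaban1983to89
open Literature.MathematicalPhysics.QuantumFieldTheory.Balaban1983to89.T3ContinuumYM3Torus
open Literature.MathematicalPhysics.QuantumFieldTheory.Balaban1983to89.T3PrintedRegularMinimiser (RegPr regPr_one)
open T4Continuum BlockAveraging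
open BlockAveraging (Idx)
open B5Eq118OneStroke (iterBlockOf)
open B7Prop1Explicit (disp)
open B10Eq27TorusAxialLog (holT transl axialT)
open B7TransferAnalyticMean (meanCLM)
open B15DeterminingSets (embIter)
open B9Eq311L2Pairing (WL2)
open B11Eq103H1Complex (SiteL2K BondL2K projR)
open Summit.QuantumFields.YangMills.Theorems.Prop8Chart (emlIterU)
open T3SectALandauChart (eta eta_pos bgUnits)
open T3RegularMinimiser (regThreshold regThreshold_pos)
open T3PrintedRegularOrbits (sites_eq regPr_gaugeAct_iff)
open T3LevelShift (siteShift bondShift)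
open Summit.QuantumFields.YangMills.Theorems.Prop7SectET3Transport (periodsT3)
open Summit.QuantumFields.YangMills.Theorems.Prop7SectET3HilbertLetters (W₂ toL2 toL2S toL2B DL2 DstarL2 covLapSite)
open Summit.QuantumFields.YangMills.Theorems.Prop7SectET3GaugeProjector (NS)
open Summit.QuantumFields.YangMills.Theorems.Prop7SectET3WilsonHessian (DeltaEta)
open Summit.QuantumFields.YangMills.Theorems.Prop7SectET3CurvedPropagators (Qk)
open Summit.QuantumFields.YangMills.Theorems.Prop7NSIntertwinerOfRecord (exists_intertwiner_of_regPr)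
open Summit.QuantumFields.YangMills.Theorems.Prop7MassivePropagatorCoercive (exists_massive_inverse)
open Summit.QuantumFields.YangMills.Theorems.Prop7LODAssemblyMemberClosed (curvedTarget_member_of_cubeRows)
open Summit.QuantumFields.YangMills.Theorems.Prop7LODTargetAllMembers (hwrap_of_room)
open Summit.QuantumFields.YangMills.Theorems.Prop7PTermLocalGaugeKnit (hseq_of_htop)

/-- ★ **THE MASSIVE FAMILIES OF RECORD EXIST** — for the flat target's intertwiner `Q1` (∃-sequence at `1`) and every cube centre `c`: the coarse reading `ι = toL2S ∘ siteShift` (`rfl`), the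
intertwiner of record `Q_c` at the cube-gauged background `W_c = (axialT U₀ c)·U₀` (✓`exists_intertwiner_of_regPr`, `RegPr W_c` by ✓`regPr_gaugeAct_iff`), the adjoints
`T_c = (ι∘Q_c)†`, `T1 = (ι∘Q1)†` (finite dimension) and the massive inverses `G_c`, `G1` of `Δ_W + am·T ι Q` (✓`exists_massive_inverse`) — the letters ✓`curvedTarget_member_of_cubeRows`
displays, produced once so that the per-cube rows are asked of THESE families only. [cite: Balaban1985BackgroundPropagators, (3.19)–(3.27) pp.393–395; Balaban1985Averaging, (97) p.32] -/
theorem exists_cube_families (F : T3Family) {n K : ℕ} (h : n ≤ K) (c₀ c₁ : ℝ) [Fact (0 < c₀)] [Fact (0 < c₁)]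
    {ε₀ : ℝ} (hε₀ : 0 < ε₀) (hε7 : 10 ^ 7 * (F.L : ℝ) ^ 3 * ε₀ ≤ 1) (hWε : 10 ^ 12 * (F.L : ℝ) ^ 3 * ε₀ ≤ 1)
    (U₀ : GaugeField (F.P K) 0 (Matrix.specialUnitaryGroup (Fin 2) ℂ)) (hreg : RegPr F n K ε₀ U₀) {am : ℝ} (ham : 0 < am)
    (Q1 : SiteL2K ℂ 3 (periodsT3 F K) c₀ W₂ →ₗ[ℂ] (Site (F.P K) (K - n) → Matrix (Fin 2) (Fin 2) ℂ))
    (hseq₁ : (∀ lam : Site (F.P K) 0 → Matrix (Fin 2) (Fin 2) ℂ, ∃ ns : (j : ℕ) → Site (F.P K) j → Matrix (Fin 2) (Fin 2) ℂ, ns 0 = lam ∧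
        (∀ (j : ℕ) (y : Site (F.P K) (j + 1)), ns (j + 1) y = ns j (emb y) - meanCLM (Idx (F.P K)) (Matrix (Fin 2) (Fin 2) ℂ) fun i : Idx (F.P K) =>
          ns j (emb y) - ((holT (emlIterU j (bgUnits F K (1 : GaugeField (F.P K) 0 (Matrix.specialUnitaryGroup (Fin 2) ℂ)))) (emb y) (stairWord i.2.1 (off i.1)) : (Matrix (Fin 2) (Fin 2) ℂ)ˣ) : Matrix (Fin 2) (Fin 2) ℂ) *
            ns j (transl (emb y) (disp (stairWord i.2.1 (off i.1)))) * (((holT (emlIterU j (bgUnits F K (1 : GaugeField (F.P K) 0 (Matrix.specialUnitaryGroup (Fin 2) ℂ)))) (emb y) (stairWord i.2.1 (off i.1)))⁻¹ : (Matrix (Fin 2) (Fin 2) ℂ)ˣ) : Matrix (Fin 2) (Fin 2) ℂ)) ∧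
        ns (K - n) = Q1 (toL2S F K c₀ lam))) :
    ∃ (ι : (Site (F.P K) (K - n) → Matrix (Fin 2) (Fin 2) ℂ) →ₗ[ℂ] SiteL2K ℂ 3 (periodsT3 F n) c₁ W₂)
      (_ : ∀ c, ι c = toL2S F n c₁ (fun z => c (siteShift (sites_eq F n K h) z)))
      (Qc : Site (F.P K) 0 → (SiteL2K ℂ 3 (periodsT3 F K) c₀ W₂ →ₗ[ℂ] (Site (F.P K) (K - n) → Matrix (Fin 2) (Fin 2) ℂ)))
      (_ : ∀ c : Site (F.P K) 0, (∀ lam : Site (F.P K) 0 → Matrix (Fin 2) (Fin 2) ℂ, ∃ ns : (j : ℕ) → Site (F.P K) j → Matrix (Fin 2) (Fin 2) ℂ, ns 0 = lam ∧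
        (∀ (j : ℕ) (y : Site (F.P K) (j + 1)), ns (j + 1) y = ns j (emb y) - meanCLM (Idx (F.P K)) (Matrix (Fin 2) (Fin 2) ℂ) fun i : Idx (F.P K) =>
          ns j (emb y) - ((holT (emlIterU j (bgUnits F K (GaugeField.gaugeAct (axialT U₀ c) U₀))) (emb y) (stairWord i.2.1 (off i.1)) : (Matrix (Fin 2) (Fin 2) ℂ)ˣ) : Matrix (Fin 2) (Fin 2) ℂ) *
            ns j (transl (emb y) (disp (stairWord i.2.1 (off i.1)))) * (((holT (emlIterU j (bgUnits F K (GaugeField.gaugeAct (axialT U₀ c) U₀))) (emb y) (stairWord i.2.1 (off i.1)))⁻¹ : (Matrix (Fin 2) (Fin 2) ℂ)ˣ) : Matrix (Fin 2) (Fin 2) ℂ)) ∧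
        ns (K - n) = Qc c (toL2S F K c₀ lam)))
      (Tc : Site (F.P K) 0 → (SiteL2K ℂ 3 (periodsT3 F n) c₁ W₂ →ₗ[ℂ] SiteL2K ℂ 3 (periodsT3 F K) c₀ W₂))
      (_ : ∀ (c : Site (F.P K) 0) (l : SiteL2K ℂ 3 (periodsT3 F K) c₀ W₂) (f : SiteL2K ℂ 3 (periodsT3 F n) c₁ W₂), ⟪ι (Qc c l), f⟫_ℂ = ⟪l, Tc c f⟫_ℂ)
      (Gc : Site (F.P K) 0 → (SiteL2K ℂ 3 (periodsT3 F K) c₀ W₂ →ₗ[ℂ] SiteL2K ℂ 3 (periodsT3 F K) c₀ W₂))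
      (_ : ∀ (c : Site (F.P K) 0) (f : SiteL2K ℂ 3 (periodsT3 F K) c₀ W₂), covLapSite F n K c₀ (GaugeField.gaugeAct (axialT U₀ c) U₀) (Gc c f) + (am : ℂ) • Tc c (ι (Qc c (Gc c f))) = f)
      (_ : ∀ (c : Site (F.P K) 0) (w : SiteL2K ℂ 3 (periodsT3 F K) c₀ W₂), Gc c (covLapSite F n K c₀ (GaugeField.gaugeAct (axialT U₀ c) U₀) w + (am : ℂ) • Tc c (ι (Qc c w))) = w)
      (T1 : SiteL2K ℂ 3 (periodsT3 F n) c₁ W₂ →ₗ[ℂ] SiteL2K ℂ 3 (periodsT3 F K) c₀ W₂) (_ : ∀ (l : SiteL2K ℂ 3 (periodsT3 F K) c₀ W₂) (f : SiteL2K ℂ 3 (periodsT3 F n) c₁ W₂), ⟪ι (Q1 l), f⟫_ℂ = ⟪l, T1 f⟫_ℂ)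
      (G1 : SiteL2K ℂ 3 (periodsT3 F K) c₀ W₂ →ₗ[ℂ] SiteL2K ℂ 3 (periodsT3 F K) c₀ W₂)
      (_ : ∀ f, covLapSite F n K c₀ (1 : GaugeField (F.P K) 0 (Matrix.specialUnitaryGroup (Fin 2) ℂ)) (G1 f) + (am : ℂ) • T1 (ι (Q1 (G1 f))) = f),
      (∀ w, G1 (covLapSite F n K c₀ (1 : GaugeField (F.P K) 0 (Matrix.specialUnitaryGroup (Fin 2) ℂ)) w + (am : ℂ) • T1 (ι (Q1 w))) = w) := by
  -- the coarse reading (opaque letter with its `rfl` reading, as in ✓`normSq_DstarL2_le_normSq_projR_add_of_regPr'`)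
  obtain ⟨ι, hι⟩ : ∃ ι : (Site (F.P K) (K - n) → Matrix (Fin 2) (Fin 2) ℂ) →ₗ[ℂ] SiteL2K ℂ 3 (periodsT3 F n) c₁ W₂,
      ∀ c, ι c = toL2S F n c₁ (fun z => c (siteShift (sites_eq F n K h) z)) :=
    ⟨(toL2S F n c₁).toLinearMap ∘ₗ LinearMap.funLeft ℂ (Matrix (Fin 2) (Fin 2) ℂ) (siteShift (sites_eq F n K h)), fun c => rfl⟩
  -- per cube: intertwiner of record, adjoint, massive inverse
  have hcube : ∀ c : Site (F.P K) 0, ∃ (Qc : SiteL2K ℂ 3 (periodsT3 F K) c₀ W₂ →ₗ[ℂ] (Site (F.P K) (K - n) → Matrix (Fin 2) (Fin 2) ℂ))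
      (_ : (∀ lam : Site (F.P K) 0 → Matrix (Fin 2) (Fin 2) ℂ, ∃ ns : (j : ℕ) → Site (F.P K) j → Matrix (Fin 2) (Fin 2) ℂ, ns 0 = lam ∧
        (∀ (j : ℕ) (y : Site (F.P K) (j + 1)), ns (j + 1) y = ns j (emb y) - meanCLM (Idx (F.P K)) (Matrix (Fin 2) (Fin 2) ℂ) fun i : Idx (F.P K) =>
          ns j (emb y) - ((holT (emlIterU j (bgUnits F K (GaugeField.gaugeAct (axialT U₀ c) U₀))) (emb y) (stairWord i.2.1 (off i.1)) : (Matrix (Fin 2) (Fin 2) ℂ)ˣ) : Matrix (Fin 2) (Fin 2) ℂ) *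
            ns j (transl (emb y) (disp (stairWord i.2.1 (off i.1)))) * (((holT (emlIterU j (bgUnits F K (GaugeField.gaugeAct (axialT U₀ c) U₀))) (emb y) (stairWord i.2.1 (off i.1)))⁻¹ : (Matrix (Fin 2) (Fin 2) ℂ)ˣ) : Matrix (Fin 2) (Fin 2) ℂ)) ∧
        ns (K - n) = Qc (toL2S F K c₀ lam)))
      (Tc : SiteL2K ℂ 3 (periodsT3 F n) c₁ W₂ →ₗ[ℂ] SiteL2K ℂ 3 (periodsT3 F K) c₀ W₂) (_ : ∀ (l : SiteL2K ℂ 3 (periodsT3 F K) c₀ W₂) (f : SiteL2K ℂ 3 (periodsT3 F n) c₁ W₂), ⟪ι (Qc l), f⟫_ℂ = ⟪l, Tc f⟫_ℂ)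
      (Gc : SiteL2K ℂ 3 (periodsT3 F K) c₀ W₂ →ₗ[ℂ] SiteL2K ℂ 3 (periodsT3 F K) c₀ W₂) (_ : ∀ f, covLapSite F n K c₀ (GaugeField.gaugeAct (axialT U₀ c) U₀) (Gc f) + (am : ℂ) • Tc (ι (Qc (Gc f))) = f),
      (∀ w, Gc (covLapSite F n K c₀ (GaugeField.gaugeAct (axialT U₀ c) U₀) w + (am : ℂ) • Tc (ι (Qc w))) = w) := by
    intro c
    have hregW : RegPr F n K ε₀ (GaugeField.gaugeAct (axialT U₀ c) U₀) := (regPr_gaugeAct_iff F hε₀.le (axialT U₀ c) U₀).mpr hreg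
    obtain ⟨Qc, Dc, -, -, -, hseqc, -⟩ := exists_intertwiner_of_regPr F h (c₀ := c₀) c₁ hε₀ hWε (GaugeField.gaugeAct (axialT U₀ c) U₀) hregW
    have hTc : ∀ (l : SiteL2K ℂ 3 (periodsT3 F K) c₀ W₂) (f : SiteL2K ℂ 3 (periodsT3 F n) c₁ W₂), ⟪ι (Qc l), f⟫_ℂ = ⟪l, LinearMap.adjoint (ι ∘ₗ Qc) f⟫_ℂ :=
      fun l f => by rw [LinearMap.adjoint_inner_right, LinearMap.comp_apply]
    obtain ⟨Gc, hAGc, hGAc, -⟩ := exists_massive_inverse F h hε₀ hε7 (GaugeField.gaugeAct (axialT U₀ c) U₀) hregW Qc hseqc ι hι (LinearMap.adjoint (ι ∘ₗ Qc)) hTc ham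
    exact ⟨Qc, hseqc, LinearMap.adjoint (ι ∘ₗ Qc), hTc, Gc, hAGc, hGAc⟩
  choose Qc hseqc Tc hTc Gc hAGc hGAc using hcube
  -- the flat system
  have hT1 : ∀ (l : SiteL2K ℂ 3 (periodsT3 F K) c₀ W₂) (f : SiteL2K ℂ 3 (periodsT3 F n) c₁ W₂), ⟪ι (Q1 l), f⟫_ℂ = ⟪l, LinearMap.adjoint (ι ∘ₗ Q1) f⟫_ℂ :=
    fun l f => by rw [LinearMap.adjoint_inner_right, LinearMap.comp_apply]
  obtain ⟨G1, hAG1, hGA1, -⟩ := exists_massive_inverse F h hε₀ hε7 (1 : GaugeField (F.P K) 0 (Matrix.specialUnitaryGroup (Fin 2) ℂ)) (regPr_one (F := F) hε₀) Q1 hseq₁ ι hι (LinearMap.adjoint (ι ∘ₗ Q1)) hT1 ham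
  exact ⟨ι, hι, Qc, hseqc, Tc, hTc, Gc, hAGc, hGAc, LinearMap.adjoint (ι ∘ₗ Q1), hT1, G1, hAG1, hGA1⟩


/-- (P1′) THE ENLARGED CUT-OFF CUBES FIT: `Rb + 11 ≤ L^{m+n}` ⟹ routeR-w3 g13's no-wrap room `2·((Rb+9)·ℓ + 2) ≤ sitesPerDir 0 = 2L^{m+K}` (`ℓ = L^{K−n} ≥ 1`). [folklore] -/
theorem hwrapRb_of_room (F : T3Family) {n K : ℕ} (hnK : n ≤ K) (Rb : ℕ) (hroom : Rb + 11 ≤ F.L ^ (F.m + n)) :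
    2 * ((Rb + 9) * F.L ^ (K - n) + 2) ≤ (F.P K).sitesPerDir 0 := by
  have hL : 3 ≤ F.L := by
    obtain ⟨⟨k, hk⟩, h1⟩ := F.hL
    omega
  show 2 * ((Rb + 9) * F.L ^ (K - n) + 2) ≤ 2 * F.L ^ (F.m + K - 0)
  rw [Nat.sub_zero]
  have hsplit : F.L ^ (F.m + K) = F.L ^ (F.m + n) * F.L ^ (K - n) := by
    rw [← pow_add]; congr 1; omega
  have hℓ : 1 ≤ F.L ^ (K - n) := Nat.one_le_pow _ _ (by omega)
  nlinarith [hsplit, hroom, hℓ]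


/-! ## §2 (D1) routeR-w3 g13's per-cube rows, weakened to LETTERS `cG`, `cQ` (the `εN` twin follows ✓`hop_of_cube`) -/

/-- (D1a) ✓`Prop7LocalProjectorRowsRBOfCube.hRB1_of_cube` with its printed constant bounded by a letter `cG`. [cite: Balaban1985BackgroundPropagators, (3.24)–(3.26) pp.394–395] -/
theorem hRB1_of_cube_le (F : T3Family) {n K : ℕ} (h : n ≤ K) {c₀ c₁ : ℝ} [Fact (0 < c₀)] [Fact (0 < c₁)]
    {ε₀ : ℝ} (hε₀ : 0 < ε₀) (hε7 : 10 ^ 7 * (F.L : ℝ) ^ 3 * ε₀ ≤ 1)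
  (U₀ : GaugeField (F.P K) 0 (Matrix.specialUnitaryGroup (Fin 2) ℂ)) (hreg : RegPr F n K ε₀ U₀)
  (ι : (Site (F.P K) (K - n) → Matrix (Fin 2) (Fin 2) ℂ) →ₗ[ℂ] SiteL2K ℂ 3 (periodsT3 F n) c₁ W₂)
  (hι : ∀ c, ι c = toL2S F n c₁ (fun z => c (siteShift (sites_eq F n K h) z)))
  {a : ℝ} (ha : 0 < a) (s : ℕ) {r : ℝ} (hr : 0 < r)
  -- per-cube letters at the cube-gauged background
  (Qc : Site (F.P K) 0 → (SiteL2K ℂ 3 (periodsT3 F K) c₀ W₂ →ₗ[ℂ] (Site (F.P K) (K - n) → Matrix (Fin 2) (Fin 2) ℂ)))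
  (hseqc : ∀ c : Site (F.P K) 0, (∀ lam : Site (F.P K) 0 → Matrix (Fin 2) (Fin 2) ℂ, ∃ ns : (j : ℕ) → Site (F.P K) j → Matrix (Fin 2) (Fin 2) ℂ, ns 0 = lam ∧
        (∀ (j : ℕ) (y : Site (F.P K) (j + 1)), ns (j + 1) y = ns j (emb y) - meanCLM (Idx (F.P K)) (Matrix (Fin 2) (Fin 2) ℂ) fun i : Idx (F.P K) =>
          ns j (emb y) - ((holT (emlIterU j (bgUnits F K (GaugeField.gaugeAct (axialT U₀ c) U₀))) (emb y) (stairWord i.2.1 (off i.1)) : (Matrix (Fin 2) (Fin 2) ℂ)ˣ) : Matrix (Fin 2) (Fin 2) ℂ) *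
            ns j (transl (emb y) (disp (stairWord i.2.1 (off i.1)))) * (((holT (emlIterU j (bgUnits F K (GaugeField.gaugeAct (axialT U₀ c) U₀))) (emb y) (stairWord i.2.1 (off i.1)))⁻¹ : (Matrix (Fin 2) (Fin 2) ℂ)ˣ) : Matrix (Fin 2) (Fin 2) ℂ)) ∧
        ns (K - n) = Qc c (toL2S F K c₀ lam)))
  (Tc : Site (F.P K) 0 → (SiteL2K ℂ 3 (periodsT3 F n) c₁ W₂ →ₗ[ℂ] SiteL2K ℂ 3 (periodsT3 F K) c₀ W₂))
  (hTc : ∀ (c : Site (F.P K) 0) (l : SiteL2K ℂ 3 (periodsT3 F K) c₀ W₂) (f : SiteL2K ℂ 3 (periodsT3 F n) c₁ W₂), ⟪ι (Qc c l), f⟫_ℂ = ⟪l, Tc c f⟫_ℂ)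
  (Gc : Site (F.P K) 0 → (SiteL2K ℂ 3 (periodsT3 F K) c₀ W₂ →ₗ[ℂ] SiteL2K ℂ 3 (periodsT3 F K) c₀ W₂))
  (hAGc : ∀ (c : Site (F.P K) 0) (f : SiteL2K ℂ 3 (periodsT3 F K) c₀ W₂), covLapSite F n K c₀ (GaugeField.gaugeAct (axialT U₀ c) U₀) (Gc c f) + (a : ℂ) • Tc c (ι (Qc c (Gc c f))) = f)
  (hGAc : ∀ (c : Site (F.P K) 0) (w : SiteL2K ℂ 3 (periodsT3 F K) c₀ W₂), Gc c (covLapSite F n K c₀ (GaugeField.gaugeAct (axialT U₀ c) U₀) w + (a : ℂ) • Tc c (ι (Qc c w))) = w)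
  -- the flat system at background `1`
  (Q1 : SiteL2K ℂ 3 (periodsT3 F K) c₀ W₂ →ₗ[ℂ] (Site (F.P K) (K - n) → Matrix (Fin 2) (Fin 2) ℂ))
  (hseq₁ : (∀ lam : Site (F.P K) 0 → Matrix (Fin 2) (Fin 2) ℂ, ∃ ns : (j : ℕ) → Site (F.P K) j → Matrix (Fin 2) (Fin 2) ℂ, ns 0 = lam ∧
        (∀ (j : ℕ) (y : Site (F.P K) (j + 1)), ns (j + 1) y = ns j (emb y) - meanCLM (Idx (F.P K)) (Matrix (Fin 2) (Fin 2) ℂ) fun i : Idx (F.P K) =>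
          ns j (emb y) - ((holT (emlIterU j (bgUnits F K (1 : GaugeField (F.P K) 0 (Matrix.specialUnitaryGroup (Fin 2) ℂ)))) (emb y) (stairWord i.2.1 (off i.1)) : (Matrix (Fin 2) (Fin 2) ℂ)ˣ) : Matrix (Fin 2) (Fin 2) ℂ) *
            ns j (transl (emb y) (disp (stairWord i.2.1 (off i.1)))) * (((holT (emlIterU j (bgUnits F K (1 : GaugeField (F.P K) 0 (Matrix.specialUnitaryGroup (Fin 2) ℂ)))) (emb y) (stairWord i.2.1 (off i.1)))⁻¹ : (Matrix (Fin 2) (Fin 2) ℂ)ˣ) : Matrix (Fin 2) (Fin 2) ℂ)) ∧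
        ns (K - n) = Q1 (toL2S F K c₀ lam)))
  (T1 : SiteL2K ℂ 3 (periodsT3 F n) c₁ W₂ →ₗ[ℂ] SiteL2K ℂ 3 (periodsT3 F K) c₀ W₂) (hT1 : ∀ (l : SiteL2K ℂ 3 (periodsT3 F K) c₀ W₂) (f : SiteL2K ℂ 3 (periodsT3 F n) c₁ W₂), ⟪ι (Q1 l), f⟫_ℂ = ⟪l, T1 f⟫_ℂ)
  (G1 : SiteL2K ℂ 3 (periodsT3 F K) c₀ W₂ →ₗ[ℂ] SiteL2K ℂ 3 (periodsT3 F K) c₀ W₂)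
  (hAG1 : ∀ f, covLapSite F n K c₀ (1 : GaugeField (F.P K) 0 (Matrix.specialUnitaryGroup (Fin 2) ℂ)) (G1 f) + (a : ℂ) • T1 (ι (Q1 (G1 f))) = f)
  (hGA1 : ∀ w, G1 (covLapSite F n K c₀ (1 : GaugeField (F.P K) 0 (Matrix.specialUnitaryGroup (Fin 2) ℂ)) w + (a : ℂ) • T1 (ι (Q1 w))) = w)
  -- cut-off parameters (routeR-w2 g13's ✓`exists_cubeCutoffs`), the coarse radius, the room, the smallness
  {ν μa Bt Bc : ℝ} (hν : 0 < ν) (hμa : 0 ≤ μa) (hBt : 1 ≤ Bt) (hBc : Bt + 1 ≤ Bc)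
  (Rb : ℕ) (hRb : 3 * (F.L : ℝ) ^ s + 4 + r + Bc / ν + 3 ≤ Rb)
  (hwrap : 2 * ((Rb + 9) * F.L ^ (K - n) + 2) ≤ (F.P K).sitesPerDir 0)
  (hεRb : 24 * ε₀ * ((Rb : ℝ) + 9) ≤ 1)
    {cG : ℝ} (hG : ((Real.sqrt (max 2 (16 * c₀ * ((F.L : ℝ) ^ (K - n)) ^ 3 / (a * c₁)))⁻¹⁻¹ * (1 + Real.sqrt (max 2 (16 * c₀ * ((F.L : ℝ) ^ (K - n)) ^ 3 / (a * c₁)))⁻¹⁻¹) * ((Real.sqrt 3 * (eta F n K)⁻¹ * (ν * eta F n K) + Real.sqrt 24 * (2 * ε₀ * ((Rb : ℝ) + 7)) + 2 * (Real.sqrt 3 * (eta F n K)⁻¹ * (ν * eta F n K)) * (Real.sqrt 24 * (2 * ε₀ * ((Rb : ℝ) + 7)))) * Real.sqrt (max 2 (16 * c₀ * ((F.L : ℝ) ^ (K - n)) ^ 3 / (a * c₁)))⁻¹⁻¹ + ((Real.sqrt 3 * (eta F n K)⁻¹ * (ν * eta F n K) + Real.sqrt 24 * (2 * ε₀ * ((Rb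 : ℝ) + 7)) + 2 * (Real.sqrt 3 * (eta F n K)⁻¹ * (ν * eta F n K)) * (Real.sqrt 24 * (2 * ε₀ * ((Rb : ℝ) + 7)))) + a * ((25 / 4) * (c₁ * ((((F.P K).L : ℝ) ^ (F.P K).d) ^ (K - n))⁻¹ / c₀) * (3 * ν) + 2 * Real.sqrt ((25 / 8) * (c₁ * ((((F.P K).L : ℝ) ^ (F.P K).d) ^ (K - n))⁻¹ / c₀)) * (Real.sqrt (2 * (c₁ * ((((F.P K).L : ℝ) ^ (F.P K).d) ^ (K - n))⁻¹ / c₀)) * (2 * (4500 * (F.L : ℝ) ^ 2 * ε₀) + 2 * 0 + 2 * (48 * ε₀ * ((Rb : ℝ) + 9)))))) * (max 2 (16 * c₀ * ((F.L : ℝ) ^ (K - n)) ^ 3 / (a * c₁)))⁻¹⁻¹)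
          + Real.sqrt (max 2 (16 * c₀ * ((F.L : ℝ) ^ (K - n)) ^ 3 / (a * c₁)))⁻¹⁻¹ * (1 + Real.sqrt (max 2 (16 * c₀ * ((F.L : ℝ) ^ (K - n)) ^ 3 / (a * c₁)))⁻¹⁻¹) * ((Real.sqrt 3 * (eta F n K)⁻¹ * (ν * eta F n K) + Real.sqrt 24 * (2 * ε₀ * ((Rb : ℝ) + 7)) + 2 * (Real.sqrt 3 * (eta F n K)⁻¹ * (ν * eta F n K)) * (Real.sqrt 24 * (2 * ε₀ * ((Rb : ℝ) + 7)))) * Real.sqrt (max 2 (16 * c₀ * ((F.L : ℝ) ^ (K - n)) ^ 3 / (a * c₁)))⁻¹⁻¹ + ((Real.sqrt 3 * (eta F n K)⁻¹ * (ν * eta F n K) + Real.sqrt 24 * (2 * ε₀ * ((Rb : ℝ) + 7)) + 2 * (Real.sqrt 3 * (eta F n K)⁻¹ * (ν * eta F n K)) * (Real.sqrt 24 * (2 * ε₀ * ((Rb : ℝ) + 7)))) + a * ((25 / 4) * (c₁ * ((((F.P K).L : ℝ) ^ (F.P K).d) ^ (K - n))⁻¹ / c₀) * (3 * ν) + 2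 * Real.sqrt ((25 / 8) * (c₁ * ((((F.P K).L : ℝ) ^ (F.P K).d) ^ (K - n))⁻¹ / c₀)) * 0)) * (max 2 (16 * c₀ * ((F.L : ℝ) ^ (K - n)) ^ 3 / (a * c₁)))⁻¹⁻¹)))
      ≤ cG) :
    ∀ (c : Site (F.P K) 0) (X : PBond (F.P K) 0 → Matrix (Fin 2) (Fin 2) ℂ),
      (∀ b : PBond (F.P K) 0, X b ≠ 0 → Site.tdist c b.src ≤ (3 * (F.L ^ s * F.L ^ (K - n)))) →
        ‖Gc c (DstarL2 F n K c₀ (GaugeField.gaugeAct (axialT U₀ c) U₀) (toL2 F K c₀ (fun b => ((axialT U₀ c b.src : Matrix.specialUnitaryGroup (Fin 2) ℂ) : Matrix (Fin 2) (Fin 2) ℂ) * X b * star ((axialT U₀ c b.src : Matrix.specialUnitaryGroup (Fin 2) ℂ) : Matrix (Fin 2) (Fin 2) ℂ)))) - G1 (DstarL2 F n K c₀ (GaugeField.gaugeAct (axialT U₀ c) U₀) (toL2 F K c₀ (fun b => ((axialT U₀ c b.src : Matrix.specialUnitaryGroup (Fin 2) ℂ) : Matrix (Fin 2) (Fin 2)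 ℂ) * X b * star ((axialT U₀ c b.src : Matrix.specialUnitaryGroup (Fin 2) ℂ) : Matrix (Fin 2) (Fin 2) ℂ))))‖ ≤ cG * ‖DstarL2 F n K c₀ (GaugeField.gaugeAct (axialT U₀ c) U₀) (toL2 F K c₀ (fun b => ((axialT U₀ c b.src : Matrix.specialUnitaryGroup (Fin 2) ℂ) : Matrix (Fin 2) (Fin 2) ℂ) * X b * star ((axialT U₀ c b.src : Matrix.specialUnitaryGroup (Fin 2) ℂ) : Matrix (Fin 2) (Fin 2) ℂ)))‖ :=
  fun c X hX => (Prop7LocalProjectorRowsRBOfCube.hRB1_of_cube F h hε₀ hε7 U₀ hreg ι hι ha s hr Qc hseqc Tc hTc Gc hAGc hGAc Q1 hseq₁ T1 hT1 G1 hAG1 hGA1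
      hν hμa hBt hBc Rb hRb hwrap hεRb c X hX).trans
    (mul_le_mul_of_nonneg_right hG (norm_nonneg _))

/-- (D1b) ✓`Prop7LocalProjectorRowsRBOfCube.hRB2_of_cube` with its printed constant bounded by a letter `cQ`. [cite: Balaban1985BackgroundPropagators, (3.105)–(3.106) p.414] -/
theorem hRB2_of_cube_le (F : T3Family) {n K : ℕ} (h : n ≤ K) {c₀ c₁ : ℝ} [Fact (0 < c₀)] [Fact (0 < c₁)]
    {ε₀ : ℝ} (hε₀ : 0 < ε₀) (hε7 : 10 ^ 7 * (F.L : ℝ) ^ 3 * ε₀ ≤ 1)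
  (U₀ : GaugeField (F.P K) 0 (Matrix.specialUnitaryGroup (Fin 2) ℂ)) (hreg : RegPr F n K ε₀ U₀)
  (ι : (Site (F.P K) (K - n) → Matrix (Fin 2) (Fin 2) ℂ) →ₗ[ℂ] SiteL2K ℂ 3 (periodsT3 F n) c₁ W₂)
  (hι : ∀ c, ι c = toL2S F n c₁ (fun z => c (siteShift (sites_eq F n K h) z)))
  {a : ℝ} (ha : 0 < a) (s : ℕ) {r : ℝ} (hr : 0 < r)
  -- per-cube letters at the cube-gauged background
  (Qc : Site (F.P K) 0 → (SiteL2K ℂ 3 (periodsT3 F K) c₀ W₂ →ₗ[ℂ] (Site (F.P K) (K - n) → Matrix (Fin 2) (Fin 2) ℂ)))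
  (hseqc : ∀ c : Site (F.P K) 0, (∀ lam : Site (F.P K) 0 → Matrix (Fin 2) (Fin 2) ℂ, ∃ ns : (j : ℕ) → Site (F.P K) j → Matrix (Fin 2) (Fin 2) ℂ, ns 0 = lam ∧
        (∀ (j : ℕ) (y : Site (F.P K) (j + 1)), ns (j + 1) y = ns j (emb y) - meanCLM (Idx (F.P K)) (Matrix (Fin 2) (Fin 2) ℂ) fun i : Idx (F.P K) =>
          ns j (emb y) - ((holT (emlIterU j (bgUnits F K (GaugeField.gaugeAct (axialT U₀ c) U₀))) (emb y) (stairWord i.2.1 (off i.1)) : (Matrix (Fin 2) (Fin 2) ℂ)ˣ) : Matrix (Fin 2) (Fin 2) ℂ) *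
            ns j (transl (emb y) (disp (stairWord i.2.1 (off i.1)))) * (((holT (emlIterU j (bgUnits F K (GaugeField.gaugeAct (axialT U₀ c) U₀))) (emb y) (stairWord i.2.1 (off i.1)))⁻¹ : (Matrix (Fin 2) (Fin 2) ℂ)ˣ) : Matrix (Fin 2) (Fin 2) ℂ)) ∧
        ns (K - n) = Qc c (toL2S F K c₀ lam)))
  -- the flat system at background `1`
  (Q1 : SiteL2K ℂ 3 (periodsT3 F K) c₀ W₂ →ₗ[ℂ] (Site (F.P K) (K - n) → Matrix (Fin 2) (Fin 2) ℂ))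
  (hseq₁ : (∀ lam : Site (F.P K) 0 → Matrix (Fin 2) (Fin 2) ℂ, ∃ ns : (j : ℕ) → Site (F.P K) j → Matrix (Fin 2) (Fin 2) ℂ, ns 0 = lam ∧
        (∀ (j : ℕ) (y : Site (F.P K) (j + 1)), ns (j + 1) y = ns j (emb y) - meanCLM (Idx (F.P K)) (Matrix (Fin 2) (Fin 2) ℂ) fun i : Idx (F.P K) =>
          ns j (emb y) - ((holT (emlIterU j (bgUnits F K (1 : GaugeField (F.P K) 0 (Matrix.specialUnitaryGroup (Fin 2) ℂ)))) (emb y) (stairWord i.2.1 (off i.1)) : (Matrix (Fin 2) (Fin 2) ℂ)ˣ) : Matrix (Fin 2) (Fin 2) ℂ) *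
            ns j (transl (emb y) (disp (stairWord i.2.1 (off i.1)))) * (((holT (emlIterU j (bgUnits F K (1 : GaugeField (F.P K) 0 (Matrix.specialUnitaryGroup (Fin 2) ℂ)))) (emb y) (stairWord i.2.1 (off i.1)))⁻¹ : (Matrix (Fin 2) (Fin 2) ℂ)ˣ) : Matrix (Fin 2) (Fin 2) ℂ)) ∧
        ns (K - n) = Q1 (toL2S F K c₀ lam)))
  (T1 : SiteL2K ℂ 3 (periodsT3 F n) c₁ W₂ →ₗ[ℂ] SiteL2K ℂ 3 (periodsT3 F K) c₀ W₂) (hT1 : ∀ (l : SiteL2K ℂ 3 (periodsT3 F K) c₀ W₂) (f : SiteL2K ℂ 3 (periodsT3 F n) c₁ W₂), ⟪ι (Q1 l), f⟫_ℂ = ⟪l, T1 f⟫_ℂ)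
  (G1 : SiteL2K ℂ 3 (periodsT3 F K) c₀ W₂ →ₗ[ℂ] SiteL2K ℂ 3 (periodsT3 F K) c₀ W₂)
  (hAG1 : ∀ f, covLapSite F n K c₀ (1 : GaugeField (F.P K) 0 (Matrix.specialUnitaryGroup (Fin 2) ℂ)) (G1 f) + (a : ℂ) • T1 (ι (Q1 (G1 f))) = f)
  -- cut-off parameters (routeR-w2 g13's ✓`exists_cubeCutoffs`), the coarse radius, the room, the smallness
  {ν μa Bt Bc : ℝ} (hν : 0 < ν) (hμa : 0 ≤ μa) (hBt : 1 ≤ Bt) (hBc : Bt + 1 ≤ Bc)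
  (Rb : ℕ) (hRb : 3 * (F.L : ℝ) ^ s + 4 + r + Bc / ν + 3 ≤ Rb)
  (hwrap : 2 * ((Rb + 9) * F.L ^ (K - n) + 2) ≤ (F.P K).sitesPerDir 0)
  (hεRb : 24 * ε₀ * ((Rb : ℝ) + 9) ≤ 1)
    {δ₁ : ℝ} (hδ₁ : 0 ≤ δ₁)
    (hδw : 3 * ((eta F n K)⁻¹) ^ 2 * (Real.exp (μa * eta F n K) - 1) ^ 2 + a * ((25 / 8) * (c₁ * ((((F.P K).L : ℝ) ^ (F.P K).d) ^ (K - n))⁻¹ / c₀)) * (Real.exp (3 * μa) - 1) ^ 2 ≤ δ₁ ^ 2)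
    (hwin : Real.sqrt (max 2 (16 * c₀ * ((F.L : ℝ) ^ (K - n)) ^ 3 / (a * c₁))) * δ₁ ≤ 1 / 10)
    {cQ : ℝ} (hQ : (Real.sqrt (2 * (c₁ * ((((F.P K).L : ℝ) ^ (F.P K).d) ^ (K - n))⁻¹ / c₀)) * (2 * (4500 * (F.L : ℝ) ^ 2 * ε₀) + 96 * ε₀ * ((Rb : ℝ) + 9)) * (max 2 (16 * c₀ * ((F.L : ℝ) ^ (K - n)) ^ 3 / (a * c₁)))
          + 2 * Real.sqrt ((25 / 8) * (c₁ * ((((F.P K).L : ℝ) ^ (F.P K).d) ^ (K - n))⁻¹ / c₀)) * (Real.exp (-(μa * ((Bt - 1) / ν))) * (8 * Real.sqrt (max 2 (16 * c₀ * ((F.L : ℝ) ^ (K - n)) ^ 3 / (a * c₁))) ^ 2)))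
      ≤ cQ) :
    ∀ (c : Site (F.P K) 0) (X : PBond (F.P K) 0 → Matrix (Fin 2) (Fin 2) ℂ),
      (∀ b : PBond (F.P K) 0, X b ≠ 0 → Site.tdist c b.src ≤ (3 * (F.L ^ s * F.L ^ (K - n)))) →
        ‖ι (Qc c (G1 (DstarL2 F n K c₀ (GaugeField.gaugeAct (axialT U₀ c) U₀) (toL2 F K c₀ (fun b => ((axialT U₀ c b.src : Matrix.specialUnitaryGroup (Fin 2) ℂ) : Matrix (Fin 2) (Fin 2) ℂ) * X b * star ((axialT U₀ c b.src : Matrix.specialUnitaryGroup (Fin 2) ℂ) : Matrix (Fin 2) (Fin 2) ℂ)))))) - ι (Q1 (G1 (DstarL2 F n K c₀ (GaugeField.gaugeAct (axialT U₀ c) U₀) (toL2 F K c₀ (fun b => ((axialT U₀ c b.src : Matrix.specialUnitaryGroup (Fin 2) ℂ) : Matrix (Fin 2) (Fin 2) ℂ) * X b * star ((axialT U₀ c b.src : Matrix.specialUnitaryGroup (Fin 2) ℂ) : Matrix (Fin 2) (Fin 2) ℂ))))))‖ ≤ cQ * ‖DstarL2 F n K c₀ (GaugeField.gaugeAct (axialT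 U₀ c) U₀) (toL2 F K c₀ (fun b => ((axialT U₀ c b.src : Matrix.specialUnitaryGroup (Fin 2) ℂ) : Matrix (Fin 2) (Fin 2) ℂ) * X b * star ((axialT U₀ c b.src : Matrix.specialUnitaryGroup (Fin 2) ℂ) : Matrix (Fin 2) (Fin 2) ℂ)))‖ :=
  fun c X hX => (Prop7LocalProjectorRowsRBOfCube.hRB2_of_cube F h hε₀ hε7 U₀ hreg ι hι ha s hr Qc hseqc Q1 hseq₁ T1 hT1 G1 hAG1
      hν hμa hBt hBc Rb hRb hwrap hεRb hδ₁ hδw hwin c X hX).trans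
    (mul_le_mul_of_nonneg_right hQ (norm_nonneg _))


/-- (D1c) ✓`Prop7GramNearRowOfCube.hop_of_cube` (routeR-w3 g13, STAGE OP) with its printed constant bounded by a letter `εN`; the OP∕RB2 window at slope `μa` displayed as in the source.
[cite: Balaban1985BackgroundPropagators, (3.24)–(3.27) pp.394–395] -/
theorem hop_of_cube_le (F : T3Family) {n K : ℕ} (h : n ≤ K) {c₀ c₁ : ℝ} [Fact (0 < c₀)] [Fact (0 < c₁)]
    {ε₀ : ℝ} (hε₀ : 0 < ε₀) (hε7 : 10 ^ 7 * (F.L : ℝ) ^ 3 * ε₀ ≤ 1)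
  (U₀ : GaugeField (F.P K) 0 (Matrix.specialUnitaryGroup (Fin 2) ℂ)) (hreg : RegPr F n K ε₀ U₀)
  (ι : (Site (F.P K) (K - n) → Matrix (Fin 2) (Fin 2) ℂ) →ₗ[ℂ] SiteL2K ℂ 3 (periodsT3 F n) c₁ W₂)
  (hι : ∀ c, ι c = toL2S F n c₁ (fun z => c (siteShift (sites_eq F n K h) z)))
  {a : ℝ} (ha : 0 < a) (s : ℕ) {r : ℝ} (hr : 0 < r)
  -- per-cube letters at the cube-gauged background
  (Qc : Site (F.P K) 0 → (SiteL2K ℂ 3 (periodsT3 F K) c₀ W₂ →ₗ[ℂ] (Site (F.P K) (K - n) → Matrix (Fin 2) (Fin 2) ℂ)))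
  (hseqc : ∀ c : Site (F.P K) 0, (∀ lam : Site (F.P K) 0 → Matrix (Fin 2) (Fin 2) ℂ, ∃ ns : (j : ℕ) → Site (F.P K) j → Matrix (Fin 2) (Fin 2) ℂ, ns 0 = lam ∧
        (∀ (j : ℕ) (y : Site (F.P K) (j + 1)), ns (j + 1) y = ns j (emb y) - meanCLM (Idx (F.P K)) (Matrix (Fin 2) (Fin 2) ℂ) fun i : Idx (F.P K) =>
          ns j (emb y) - ((holT (emlIterU j (bgUnits F K (GaugeField.gaugeAct (axialT U₀ c) U₀))) (emb y) (stairWord i.2.1 (off i.1)) : (Matrix (Fin 2) (Fin 2) ℂ)ˣ) : Matrix (Fin 2) (Fin 2) ℂ) *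
            ns j (transl (emb y) (disp (stairWord i.2.1 (off i.1)))) * (((holT (emlIterU j (bgUnits F K (GaugeField.gaugeAct (axialT U₀ c) U₀))) (emb y) (stairWord i.2.1 (off i.1)))⁻¹ : (Matrix (Fin 2) (Fin 2) ℂ)ˣ) : Matrix (Fin 2) (Fin 2) ℂ)) ∧
        ns (K - n) = Qc c (toL2S F K c₀ lam)))
  (Tc : Site (F.P K) 0 → (SiteL2K ℂ 3 (periodsT3 F n) c₁ W₂ →ₗ[ℂ] SiteL2K ℂ 3 (periodsT3 F K) c₀ W₂))
  (hTc : ∀ (c : Site (F.P K) 0) (l : SiteL2K ℂ 3 (periodsT3 F K) c₀ W₂) (f : SiteL2K ℂ 3 (periodsT3 F n) c₁ W₂), ⟪ι (Qc c l), f⟫_ℂ = ⟪l, Tc c f⟫_ℂ)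
  (Gc : Site (F.P K) 0 → (SiteL2K ℂ 3 (periodsT3 F K) c₀ W₂ →ₗ[ℂ] SiteL2K ℂ 3 (periodsT3 F K) c₀ W₂))
  (hAGc : ∀ (c : Site (F.P K) 0) (f : SiteL2K ℂ 3 (periodsT3 F K) c₀ W₂), covLapSite F n K c₀ (GaugeField.gaugeAct (axialT U₀ c) U₀) (Gc c f) + (a : ℂ) • Tc c (ι (Qc c (Gc c f))) = f)
  (hGAc : ∀ (c : Site (F.P K) 0) (w : SiteL2K ℂ 3 (periodsT3 F K) c₀ W₂), Gc c (covLapSite F n K c₀ (GaugeField.gaugeAct (axialT U₀ c) U₀) w + (a : ℂ) • Tc c (ι (Qc c w))) = w)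
  -- the flat system at background `1`
  (Q1 : SiteL2K ℂ 3 (periodsT3 F K) c₀ W₂ →ₗ[ℂ] (Site (F.P K) (K - n) → Matrix (Fin 2) (Fin 2) ℂ))
  (hseq₁ : (∀ lam : Site (F.P K) 0 → Matrix (Fin 2) (Fin 2) ℂ, ∃ ns : (j : ℕ) → Site (F.P K) j → Matrix (Fin 2) (Fin 2) ℂ, ns 0 = lam ∧
        (∀ (j : ℕ) (y : Site (F.P K) (j + 1)), ns (j + 1) y = ns j (emb y) - meanCLM (Idx (F.P K)) (Matrix (Fin 2) (Fin 2) ℂ) fun i : Idx (F.P K) =>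
          ns j (emb y) - ((holT (emlIterU j (bgUnits F K (1 : GaugeField (F.P K) 0 (Matrix.specialUnitaryGroup (Fin 2) ℂ)))) (emb y) (stairWord i.2.1 (off i.1)) : (Matrix (Fin 2) (Fin 2) ℂ)ˣ) : Matrix (Fin 2) (Fin 2) ℂ) *
            ns j (transl (emb y) (disp (stairWord i.2.1 (off i.1)))) * (((holT (emlIterU j (bgUnits F K (1 : GaugeField (F.P K) 0 (Matrix.specialUnitaryGroup (Fin 2) ℂ)))) (emb y) (stairWord i.2.1 (off i.1)))⁻¹ : (Matrix (Fin 2) (Fin 2) ℂ)ˣ) : Matrix (Fin 2) (Fin 2) ℂ)) ∧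
        ns (K - n) = Q1 (toL2S F K c₀ lam)))
  (T1 : SiteL2K ℂ 3 (periodsT3 F n) c₁ W₂ →ₗ[ℂ] SiteL2K ℂ 3 (periodsT3 F K) c₀ W₂) (hT1 : ∀ (l : SiteL2K ℂ 3 (periodsT3 F K) c₀ W₂) (f : SiteL2K ℂ 3 (periodsT3 F n) c₁ W₂), ⟪ι (Q1 l), f⟫_ℂ = ⟪l, T1 f⟫_ℂ)
  (G1 : SiteL2K ℂ 3 (periodsT3 F K) c₀ W₂ →ₗ[ℂ] SiteL2K ℂ 3 (periodsT3 F K) c₀ W₂)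
  (hAG1 : ∀ f, covLapSite F n K c₀ (1 : GaugeField (F.P K) 0 (Matrix.specialUnitaryGroup (Fin 2) ℂ)) (G1 f) + (a : ℂ) • T1 (ι (Q1 (G1 f))) = f)
  (hGA1 : ∀ w, G1 (covLapSite F n K c₀ (1 : GaugeField (F.P K) 0 (Matrix.specialUnitaryGroup (Fin 2) ℂ)) w + (a : ℂ) • T1 (ι (Q1 w))) = w)
  -- cut-off parameters (routeR-w2 g13's ✓`exists_cubeCutoffs`), the coarse radius, the room, the smallness
  {ν μa Bt Bc : ℝ} (hν : 0 < ν) (hμa : 0 ≤ μa) (hBt : 1 ≤ Bt) (hBc : Bt + 1 ≤ Bc)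
  (Rb : ℕ) (hRb : 3 * (F.L : ℝ) ^ s + 4 + r + Bc / ν + 3 ≤ Rb)
  (hwrap : 2 * ((Rb + 9) * F.L ^ (K - n) + 2) ≤ (F.P K).sitesPerDir 0)
  (hεRb : 24 * ε₀ * ((Rb : ℝ) + 9) ≤ 1)
    {δ₁ : ℝ} (hδ₁ : 0 ≤ δ₁)
    (hδw : 3 * ((eta F n K)⁻¹) ^ 2 * (Real.exp (μa * eta F n K) - 1) ^ 2 + a * ((25 / 8) * (c₁ * ((((F.P K).L : ℝ) ^ (F.P K).d) ^ (K - n))⁻¹ / c₀)) * (Real.exp (3 * μa) - 1) ^ 2 ≤ δ₁ ^ 2)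
    (hwin : Real.sqrt (max 2 (16 * c₀ * ((F.L : ℝ) ^ (K - n)) ^ 3 / (a * c₁))) * δ₁ ≤ 1 / 10)
    {εN : ℝ} (hN : ((Real.sqrt (2 * (c₁ * ((((F.P K).L : ℝ) ^ (F.P K).d) ^ (K - n))⁻¹ / c₀)) * (2 * (4500 * (F.L : ℝ) ^ 2 * ε₀) + 96 * ε₀ * ((Rb : ℝ) + 9))) * ((max 2 (16 * c₀ * ((F.L : ℝ) ^ (K - n)) ^ 3 / (a * c₁))) ^ 2 * Real.sqrt ((25 / 8) * (c₁ * ((((F.P K).L : ℝ) ^ (F.P K).d) ^ (K - n))⁻¹ / c₀))) + (2 * Real.sqrt ((25 / 8) * (c₁ * ((((F.P K).L : ℝ) ^ (F.P K).d) ^ (K - n))⁻¹ / c₀))) * (Real.exp (-(μa * ((Bt - 1) / ν))) * (8 * Real.sqrt (max 2 (16 * c₀ * ((F.L : ℝ) ^ (K - n)) ^ 3 / (a * c₁))) ^ 2) ^ 2 * Real.sqrt ((25 / 8) * (c₁ * ((((F.P K).L : ℝ) ^ (F.P K).d) ^ (K - n))⁻¹ / c₀))) + Real.sqrt ((25 /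 8) * (c₁ * ((((F.P K).L : ℝ) ^ (F.P K).d) ^ (K - n))⁻¹ / c₀)) * ((Real.sqrt (max 2 (16 * c₀ * ((F.L : ℝ) ^ (K - n)) ^ 3 / (a * c₁)))⁻¹⁻¹ * (1 + Real.sqrt (max 2 (16 * c₀ * ((F.L : ℝ) ^ (K - n)) ^ 3 / (a * c₁)))⁻¹⁻¹) * ((Real.sqrt 3 * (eta F n K)⁻¹ * (ν * eta F n K) + Real.sqrt 24 * (2 * ε₀ * ((Rb : ℝ) + 7)) + 2 * (Real.sqrt 3 * (eta F n K)⁻¹ * (ν * eta F n K)) * (Real.sqrt 24 * (2 * ε₀ * ((Rb : ℝ) + 7)))) * Real.sqrt (max 2 (16 * c₀ * ((F.L : ℝ) ^ (K - n)) ^ 3 / (a * c₁)))⁻¹⁻¹ + ((Real.sqrt 3 * (eta F n K)⁻¹ * (ν * eta F n K) + Real.sqrt 24 * (2 * ε₀ * ((Rb : ℝ) + 7)) + 2 * (Real.sqrt 3 * (eta F n K)⁻¹ * (ν * eta F n K)) * (Real.sqrt 24 * (2 * ε₀ * ((Rb : ℝ) + 7)))) + a * ((25 / 4) * (c₁ *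 ((((F.P K).L : ℝ) ^ (F.P K).d) ^ (K - n))⁻¹ / c₀) * (3 * ν) + 2 * Real.sqrt ((25 / 8) * (c₁ * ((((F.P K).L : ℝ) ^ (F.P K).d) ^ (K - n))⁻¹ / c₀)) * (Real.sqrt (2 * (c₁ * ((((F.P K).L : ℝ) ^ (F.P K).d) ^ (K - n))⁻¹ / c₀)) * (2 * (4500 * (F.L : ℝ) ^ 2 * ε₀) + 2 * 0 + 2 * (48 * ε₀ * ((Rb : ℝ) + 9)))))) * (max 2 (16 * c₀ * ((F.L : ℝ) ^ (K - n)) ^ 3 / (a * c₁)))⁻¹⁻¹) + Real.sqrt (max 2 (16 * c₀ * ((F.L : ℝ) ^ (K - n)) ^ 3 / (a * c₁)))⁻¹⁻¹ * (1 + Real.sqrt (max 2 (16 * c₀ * ((F.L : ℝ) ^ (K - n)) ^ 3 / (a * c₁)))⁻¹⁻¹) * ((Real.sqrt 3 * (eta F n K)⁻¹ * (ν * eta F n K) + Real.sqrt 24 * (2 * ε₀ * ((Rb : ℝ) + 7)) + 2 * (Real.sqrt 3 * (eta F n K)⁻¹ * (ν * eta F n K)) * (Real.sqrt 24 * (2 *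 ε₀ * ((Rb : ℝ) + 7)))) * Real.sqrt (max 2 (16 * c₀ * ((F.L : ℝ) ^ (K - n)) ^ 3 / (a * c₁)))⁻¹⁻¹ + ((Real.sqrt 3 * (eta F n K)⁻¹ * (ν * eta F n K) + Real.sqrt 24 * (2 * ε₀ * ((Rb : ℝ) + 7)) + 2 * (Real.sqrt 3 * (eta F n K)⁻¹ * (ν * eta F n K)) * (Real.sqrt 24 * (2 * ε₀ * ((Rb : ℝ) + 7)))) + a * ((25 / 4) * (c₁ * ((((F.P K).L : ℝ) ^ (F.P K).d) ^ (K - n))⁻¹ / c₀) * (3 * ν) + 2 * Real.sqrt ((25 / 8) * (c₁ * ((((F.P K).L : ℝ) ^ (F.P K).d) ^ (K - n))⁻¹ / c₀)) * 0)) * (max 2 (16 * c₀ * ((F.L : ℝ) ^ (K - n)) ^ 3 / (a * c₁)))⁻¹⁻¹)) * ((max 2 (16 * c₀ * ((F.L : ℝ) ^ (K - n)) ^ 3 / (a * c₁))) * Real.sqrt ((25 / 8) * (c₁ * ((((F.P K).L : ℝ) ^ (F.P K).d) ^ (K - n))⁻¹ / c₀)))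
          + 2 * (max 2 (16 * c₀ * ((F.L : ℝ) ^ (K - n)) ^ 3 / (a * c₁))) * (Real.exp (-(μa * ((Bt - 1) / ν))) * (8 * Real.sqrt (max 2 (16 * c₀ * ((F.L : ℝ) ^ (K - n)) ^ 3 / (a * c₁))) ^ 2) * Real.sqrt ((25 / 8) * (c₁ * ((((F.P K).L : ℝ) ^ (F.P K).d) ^ (K - n))⁻¹ / c₀))) + (max 2 (16 * c₀ * ((F.L : ℝ) ^ (K - n)) ^ 3 / (a * c₁))) * ((Real.sqrt (max 2 (16 * c₀ * ((F.L : ℝ) ^ (K - n)) ^ 3 / (a * c₁)))⁻¹⁻¹ * (1 + Real.sqrt (max 2 (16 * c₀ * ((F.L : ℝ) ^ (K - n)) ^ 3 / (a * c₁)))⁻¹⁻¹) * ((Real.sqrt 3 * (eta F n K)⁻¹ * (ν * eta F n K) + Real.sqrt 24 * (2 * ε₀ * ((Rb : ℝ) + 7)) + 2 * (Real.sqrt 3 * (eta F n K)⁻¹ * (ν * eta F n K)) * (Real.sqrt 24 * (2 * ε₀ * ((Rb : ℝ) + 7)))) * Real.sqrt (max 2 (16 * c₀ * ((F.L : ℝ)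 ^ (K - n)) ^ 3 / (a * c₁)))⁻¹⁻¹ + ((Real.sqrt 3 * (eta F n K)⁻¹ * (ν * eta F n K) + Real.sqrt 24 * (2 * ε₀ * ((Rb : ℝ) + 7)) + 2 * (Real.sqrt 3 * (eta F n K)⁻¹ * (ν * eta F n K)) * (Real.sqrt 24 * (2 * ε₀ * ((Rb : ℝ) + 7)))) + a * ((25 / 4) * (c₁ * ((((F.P K).L : ℝ) ^ (F.P K).d) ^ (K - n))⁻¹ / c₀) * (3 * ν) + 2 * Real.sqrt ((25 / 8) * (c₁ * ((((F.P K).L : ℝ) ^ (F.P K).d) ^ (K - n))⁻¹ / c₀)) * (Real.sqrt (2 * (c₁ * ((((F.P K).L : ℝ) ^ (F.P K).d) ^ (K - n))⁻¹ / c₀)) * (2 * (4500 * (F.L : ℝ) ^ 2 * ε₀) + 2 * 0 + 2 * (48 * ε₀ * ((Rb : ℝ) + 9)))))) * (max 2 (16 * c₀ * ((F.L : ℝ) ^ (K - n)) ^ 3 / (a * c₁)))⁻¹⁻¹) + Real.sqrt (max 2 (16 * c₀ * ((F.L : ℝ) ^ (K - n)) ^ 3 / (a * c₁)))⁻¹⁻¹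 * (1 + Real.sqrt (max 2 (16 * c₀ * ((F.L : ℝ) ^ (K - n)) ^ 3 / (a * c₁)))⁻¹⁻¹) * ((Real.sqrt 3 * (eta F n K)⁻¹ * (ν * eta F n K) + Real.sqrt 24 * (2 * ε₀ * ((Rb : ℝ) + 7)) + 2 * (Real.sqrt 3 * (eta F n K)⁻¹ * (ν * eta F n K)) * (Real.sqrt 24 * (2 * ε₀ * ((Rb : ℝ) + 7)))) * Real.sqrt (max 2 (16 * c₀ * ((F.L : ℝ) ^ (K - n)) ^ 3 / (a * c₁)))⁻¹⁻¹ + ((Real.sqrt 3 * (eta F n K)⁻¹ * (ν * eta F n K) + Real.sqrt 24 * (2 * ε₀ * ((Rb : ℝ) + 7)) + 2 * (Real.sqrt 3 * (eta F n K)⁻¹ * (ν * eta F n K)) * (Real.sqrt 24 * (2 * ε₀ * ((Rb : ℝ) + 7)))) + a * ((25 / 4) * (c₁ * ((((F.P K).L : ℝ) ^ (F.P K).d) ^ (K - n))⁻¹ / c₀) * (3 * ν) + 2 * Real.sqrt ((25 / 8) * (c₁ * ((((F.P K).L : ℝ) ^ (F.P K).d) ^ (K - n))⁻¹ / c₀))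 * 0)) * (max 2 (16 * c₀ * ((F.L : ℝ) ^ (K - n)) ^ 3 / (a * c₁)))⁻¹⁻¹)) * Real.sqrt ((25 / 8) * (c₁ * ((((F.P K).L : ℝ) ^ (F.P K).d) ^ (K - n))⁻¹ / c₀)))
          + (max 2 (16 * c₀ * ((F.L : ℝ) ^ (K - n)) ^ 3 / (a * c₁))) ^ 2 * (Real.sqrt (2 * (c₁ * ((((F.P K).L : ℝ) ^ (F.P K).d) ^ (K - n))⁻¹ / c₀)) * (2 * (4500 * (F.L : ℝ) ^ 2 * ε₀) + 2 * 0 + 2 * (48 * ε₀ * ((Rb : ℝ) + 9))))))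
      ≤ εN) :
    ∀ (c : Site (F.P K) 0) (db : Site (F.P K) (K - n) → Matrix (Fin 2) (Fin 2) ℂ),
      (∀ z, db z ≠ 0 → ∃ z' ∈ (Finset.univ.filter fun z : Site (F.P K) (K - n) => Site.tdist z (iterBlockOf (K - n) c) ≤ 3 * F.L ^ s + 4), (Site.tdist (P := F.P K) z' z : ℝ) < r) →
        ‖ι (Q1 (G1 (G1 (T1 (ι db))))) - ι (Qc c (Gc c (Gc c (Tc c (ι db)))))‖ ≤ εN * ‖ι db‖ :=
  fun c db hdb => (Prop7GramNearRowOfCube.hop_of_cube F h hε₀ hε7 U₀ hreg ι hι ha s hr Qc hseqc Tc hTc Gc hAGc hGAc Q1 hseq₁ T1 hT1 G1 hAG1 hGA1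
      hν hμa hBt hBc Rb hRb hwrap hεRb hδ₁ hδw hwin c db hdb).trans
    (mul_le_mul_of_nonneg_right hN (norm_nonneg _))


/-! ## §3 (D2) THE CURVED TARGET AT ONE LARGE MEMBER WITH ONLY NUMERIC LETTERS DISPLAYED -/

set_option maxHeartbeats 400000 in
/-- ★★★ **(D2) `curvedTarget_member_numeric`** — ✓p761358 `curvedTarget_member_of_cubeRows` with the massive families OF RECORD (§1), routeR-w3 g13's per-cube rows (D1, letters
`cG cQ εN` with `hG hQ hN : ⟨printed constant at the pins⟩ ≤ letter`), the OP∕RB2 window at a slope letter `μa` (`0 ≤ μa`, `3μa ≤ 1`, win row `√(max 2 (16∕am))·√(27 + (2025∕8)am)·μa ≤ 1∕10`; routeR-w4's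
✓`window_delta`), ★p1's pin `hc₁ : c₁ = c₀·(L³)^{K−n}` (letter `c₁`, so the printed constants stay verbatim), ✓`hwrap_of_room`∕✓`hwrapRb_of_room`, and ✓`deltaPmax_le_of_budget` (four quarter-budgets at `t := δP`).  DISPLAYED: numeric
letters ONLY — `θ θc κP δP am a₀ ε₀ s r ν μa Bt Bc Rb cG cQ εN c₁` with short hypotheses plus the three `⟨printed constant⟩ ≤ letter` rows (the grand window (D3) chooses them).  CONDITIONAL; the window `γ > 0` is NOT asserted.
[cite: Balaban1985BackgroundPropagators, (3.20)–(3.27) pp.394–395, (3.49) p.399, (3.100) pp.413–414, Thm 3.11 p.416; Balaban1984PropagatorsI, Prop. 1.1 (1.90) p.33] -/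
theorem curvedTarget_member_numeric (F : T3Family) {n K : ℕ} (h : n ≤ K) (c₀ cB : ℝ) [Fact (0 < c₀)] [Fact (0 < cB)]
    {ε₀ : ℝ} (hε₀ : 0 < ε₀) (hε : 10 ^ 10 * (F.L : ℝ) ^ 6 * ε₀ ≤ 1) (hε12 : 10 ^ 12 * (F.L : ℝ) ^ 3 * ε₀ ≤ 1)
    (U₀ : GaugeField (F.P K) 0 (Matrix.specialUnitaryGroup (Fin 2) ℂ)) (hreg : RegPr F n K ε₀ U₀)
    (s : ℕ) (hnK : n < K) (hs : s < F.m + n)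
    (hs1 : 1 ≤ s) (hroom : s + 2 ≤ F.m + n)
    {a₀ : ℝ} (ha₀ : 0 < a₀)
    (QU : SiteL2K ℂ 3 (periodsT3 F K) c₀ W₂ →ₗ[ℂ] (Site (F.P K) (K - n) → Matrix (Fin 2) (Fin 2) ℂ))
    (htop : ∀ (lam : Site (F.P K) 0 → Matrix (Fin 2) (Fin 2) ℂ) (ns : (j : ℕ) → Site (F.P K) j → Matrix (Fin 2) (Fin 2) ℂ), ns 0 = lam →
      (∀ (j : ℕ) (y : Site (F.P K) (j + 1)), ns (j + 1) y = ns j (emb y) - meanCLM (Idx (F.P K)) (Matrix (Fin 2) (Fin 2) ℂ) fun i : Idx (F.P K) =>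
          ns j (emb y) - ((holT (emlIterU j (bgUnits F K U₀)) (emb y) (stairWord i.2.1 (off i.1)) : (Matrix (Fin 2) (Fin 2) ℂ)ˣ) : Matrix (Fin 2) (Fin 2) ℂ) *
            ns j (transl (emb y) (disp (stairWord i.2.1 (off i.1)))) * (((holT (emlIterU j (bgUnits F K U₀)) (emb y) (stairWord i.2.1 (off i.1)))⁻¹ : (Matrix (Fin 2) (Fin 2) ℂ)ˣ) : Matrix (Fin 2) (Fin 2) ℂ)) →
      ns (K - n) = QU (toL2S F K c₀ lam))
    (Q1 : SiteL2K ℂ 3 (periodsT3 F K) c₀ W₂ →ₗ[ℂ] (Site (F.P K) (K - n) → Matrix (Fin 2) (Fin 2) ℂ))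
    (htop₁ : ∀ (lam : Site (F.P K) 0 → Matrix (Fin 2) (Fin 2) ℂ) (ns : (j : ℕ) → Site (F.P K) j → Matrix (Fin 2) (Fin 2) ℂ), ns 0 = lam →
      (∀ (j : ℕ) (y : Site (F.P K) (j + 1)), ns (j + 1) y = ns j (emb y) - meanCLM (Idx (F.P K)) (Matrix (Fin 2) (Fin 2) ℂ) fun i : Idx (F.P K) =>
          ns j (emb y) - ((holT (emlIterU j (bgUnits F K (1 : GaugeField (F.P K) 0 (Matrix.specialUnitaryGroup (Fin 2) ℂ)))) (emb y) (stairWord i.2.1 (off i.1)) : (Matrix (Fin 2) (Fin 2) ℂ)ˣ) : Matrix (Fin 2) (Fin 2) ℂ) *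
            ns j (transl (emb y) (disp (stairWord i.2.1 (off i.1)))) * (((holT (emlIterU j (bgUnits F K (1 : GaugeField (F.P K) 0 (Matrix.specialUnitaryGroup (Fin 2) ℂ)))) (emb y) (stairWord i.2.1 (off i.1)))⁻¹ : (Matrix (Fin 2) (Fin 2) ℂ)ˣ) : Matrix (Fin 2) (Fin 2) ℂ)) →
      ns (K - n) = Q1 (toL2S F K c₀ lam))
    (hker₁ : LinearMap.ker Q1 ≤ NS F n K h c₀ cB (1 : GaugeField (F.P K) 0 (Matrix.specialUnitaryGroup (Fin 2) ℂ)))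
    {θ θc δP κP am : ℝ} (hθ : 0 < θ) (hθc : 0 < θc) (hδP : 0 < δP) (hsmall : 3 * θc + δP ≤ 1) (ham : 0 < am)
    (hκP : Real.sqrt (((2 * 2880 * (((24 * (max 2 (16 / am)) * Real.sqrt (25 / 8)) ^ 2 * (18 / (2 / ((1 + 25 / 8) * (600 * (27 / 4 : ℝ) ^ 6 + am))) ^ 2) * (4 * (2 * (1 + 2 / (1 / (10 * Real.sqrt (max 2 (16 / am)) * Real.sqrt (27 + 2025 / 8 * am))))) ^ 3) ^ 2) * (2 * (2 / (1 / (10 * Real.sqrt (max 2 (16 / am)) * Real.sqrt (27 + 2025 / 8 * am))) + 3 * ((Real.sqrt (max 2 (16 / am)) * (2 + Real.sqrt (max 2 (16 / am))) * (3 * Real.sqrt 3 + 27 + 9 * Real.sqrt am * Real.sqrt (25 / 8) + 81 * am * (25 / 8))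
          * (8 * Real.sqrt (max 2 (16 / am)) + 8 * Real.sqrt (max 2 (16 / am)) ^ 2) * (10 * Real.sqrt (25 / 8)) + 9 * (max 2 (16 / am)) * Real.sqrt (25 / 8))) / (2 / ((1 + 25 / 8) * (600 * (27 / 4 : ℝ) ^ 6 + am)))) * (2 * (1 + 2 * (2 / (1 / (10 * Real.sqrt (max 2 (16 / am)) * Real.sqrt (27 + 2025 / 8 * am))) + 3 * ((Real.sqrt (max 2 (16 / am)) * (2 + Real.sqrt (max 2 (16 / am))) * (3 * Real.sqrt 3 + 27 + 9 * Real.sqrt am * Real.sqrt (25 / 8) + 81 * am * (25 / 8))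
          * (8 * Real.sqrt (max 2 (16 / am)) + 8 * Real.sqrt (max 2 (16 / am)) ^ 2) * (10 * Real.sqrt (25 / 8)) + 9 * (max 2 (16 / am)) * Real.sqrt (25 / 8))) / (2 / ((1 + 25 / 8) * (600 * (27 / 4 : ℝ) ^ 6 + am)))))) ^ 3)) ^ 2 + 72 * 2880 * (((24 * (max 2 (16 / am)) * Real.sqrt (25 / 8)) ^ 2 * (18 / (2 / ((1 + 25 / 8) * (600 * (27 / 4 : ℝ) ^ 6 + am))) ^ 2) * (4 * (2 * (1 + 2 / (1 / (10 * Real.sqrt (max 2 (16 / am)) * Real.sqrt (27 + 2025 / 8 * am))))) ^ 3) ^ 2) * (2 * (1 + (2 / (1 / (10 * Real.sqrt (max 2 (16 / am)) * Real.sqrt (27 + 2025 / 8 * am))) + 3 * ((Real.sqrt (max 2 (16 / am)) * (2 + Real.sqrt (max 2 (16 / am))) * (3 * Real.sqrt 3 + 27 + 9 * Real.sqrt am * Real.sqrt (25 / 8) + 81 * am * (25 / 8))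
          * (8 * Real.sqrt (max 2 (16 / am)) + 8 * Real.sqrt (max 2 (16 / am)) ^ 2) * (10 * Real.sqrt (25 / 8)) + 9 * (max 2 (16 / am)) * Real.sqrt (25 / 8))) / (2 / ((1 + 25 / 8) * (600 * (27 / 4 : ℝ) ^ 6 + am)))))) ^ 3) ^ 2))
              / ((F.L : ℝ) ^ s) ^ 2) ≤ κP)
    {ν Bt Bc r cG cQ εN : ℝ} (hν : 0 < ν) (hBt : 1 ≤ Bt) (hBc : Bt + 1 ≤ Bc) (hr : 0 < r) (hcG : 0 ≤ cG) (hcQ : 0 ≤ cQ) (hεN : 0 ≤ εN)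
    (Rb : ℕ) (hRb : 3 * (F.L : ℝ) ^ s + 4 + r + Bc / ν + 3 ≤ Rb) (hroomRb : Rb + 11 ≤ F.L ^ (F.m + n)) (hεRb : 24 * ε₀ * ((Rb : ℝ) + 9) ≤ 1)
    {c₁ : ℝ} [Fact (0 < c₁)] (hc₁ : c₁ = c₀ * ((F.L : ℝ) ^ 3) ^ (K - n))
    {μa : ℝ} (hμa : 0 ≤ μa) (hμa3 : 3 * μa ≤ 1) (hwinμ : Real.sqrt (max 2 (16 / am)) * (Real.sqrt (27 + 2025 / 8 * am) * μa) ≤ 1 / 10)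
    (hG : ((Real.sqrt (max 2 (16 * c₀ * ((F.L : ℝ) ^ (K - n)) ^ 3 / (am * c₁)))⁻¹⁻¹ * (1 + Real.sqrt (max 2 (16 * c₀ * ((F.L : ℝ) ^ (K - n)) ^ 3 / (am * c₁)))⁻¹⁻¹) * ((Real.sqrt 3 * (eta F n K)⁻¹ * (ν * eta F n K) + Real.sqrt 24 * (2 * ε₀ * ((Rb : ℝ) + 7)) + 2 * (Real.sqrt 3 * (eta F n K)⁻¹ * (ν * eta F n K)) * (Real.sqrt 24 * (2 * ε₀ * ((Rb : ℝ) + 7)))) * Real.sqrt (max 2 (16 * c₀ * ((F.L : ℝ) ^ (K - n)) ^ 3 / (am * c₁)))⁻¹⁻¹ + ((Real.sqrt 3 * (eta F n K)⁻¹ * (ν * eta F n K) + Real.sqrt 24 * (2 * ε₀ * ((Rb : ℝ) + 7)) + 2 * (Real.sqrt 3 * (eta F n K)⁻¹ * (ν * eta F n K)) * (Real.sqrt 24 * (2 * ε₀ * ((Rb : ℝ) + 7)))) + am * ((25 / 4) * (c₁ * ((((F.P K).L : ℝ) ^ (F.P K).d) ^ (K - n))⁻¹ / c₀) * (3 * ν)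 + 2 * Real.sqrt ((25 / 8) * (c₁ * ((((F.P K).L : ℝ) ^ (F.P K).d) ^ (K - n))⁻¹ / c₀)) * (Real.sqrt (2 * (c₁ * ((((F.P K).L : ℝ) ^ (F.P K).d) ^ (K - n))⁻¹ / c₀)) * (2 * (4500 * (F.L : ℝ) ^ 2 * ε₀) + 2 * 0 + 2 * (48 * ε₀ * ((Rb : ℝ) + 9)))))) * (max 2 (16 * c₀ * ((F.L : ℝ) ^ (K - n)) ^ 3 / (am * c₁)))⁻¹⁻¹)
          + Real.sqrt (max 2 (16 * c₀ * ((F.L : ℝ) ^ (K - n)) ^ 3 / (am * c₁)))⁻¹⁻¹ * (1 + Real.sqrt (max 2 (16 * c₀ * ((F.L : ℝ) ^ (K - n)) ^ 3 / (am * c₁)))⁻¹⁻¹) * ((Real.sqrt 3 * (eta F n K)⁻¹ * (ν * eta F n K) + Real.sqrt 24 * (2 * ε₀ * ((Rb : ℝ) + 7)) + 2 * (Real.sqrt 3 * (eta F n K)⁻¹ * (ν * eta F n K)) * (Real.sqrt 24 * (2 * ε₀ * ((Rb : ℝ) + 7)))) * Real.sqrt (max 2 (16 * c₀ * ((F.L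 : ℝ) ^ (K - n)) ^ 3 / (am * c₁)))⁻¹⁻¹ + ((Real.sqrt 3 * (eta F n K)⁻¹ * (ν * eta F n K) + Real.sqrt 24 * (2 * ε₀ * ((Rb : ℝ) + 7)) + 2 * (Real.sqrt 3 * (eta F n K)⁻¹ * (ν * eta F n K)) * (Real.sqrt 24 * (2 * ε₀ * ((Rb : ℝ) + 7)))) + am * ((25 / 4) * (c₁ * ((((F.P K).L : ℝ) ^ (F.P K).d) ^ (K - n))⁻¹ / c₀) * (3 * ν) + 2 * Real.sqrt ((25 / 8) * (c₁ * ((((F.P K).L : ℝ) ^ (F.P K).d) ^ (K - n))⁻¹ / c₀)) * 0)) * (max 2 (16 * c₀ * ((F.L : ℝ) ^ (K - n)) ^ 3 / (am * c₁)))⁻¹⁻¹)))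
      ≤ cG)
    (hQ : (Real.sqrt (2 * (c₁ * ((((F.P K).L : ℝ) ^ (F.P K).d) ^ (K - n))⁻¹ / c₀)) * (2 * (4500 * (F.L : ℝ) ^ 2 * ε₀) + 96 * ε₀ * ((Rb : ℝ) + 9)) * (max 2 (16 * c₀ * ((F.L : ℝ) ^ (K - n)) ^ 3 / (am * c₁)))
          + 2 * Real.sqrt ((25 / 8) * (c₁ * ((((F.P K).L : ℝ) ^ (F.P K).d) ^ (K - n))⁻¹ / c₀)) * (Real.exp (-(μa * ((Bt - 1) / ν))) * (8 * Real.sqrt (max 2 (16 * c₀ * ((F.L : ℝ) ^ (K - n)) ^ 3 / (am * c₁))) ^ 2)))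
      ≤ cQ)
    (hN : ((Real.sqrt (2 * (c₁ * ((((F.P K).L : ℝ) ^ (F.P K).d) ^ (K - n))⁻¹ / c₀)) * (2 * (4500 * (F.L : ℝ) ^ 2 * ε₀) + 96 * ε₀ * ((Rb : ℝ) + 9))) * ((max 2 (16 * c₀ * ((F.L : ℝ) ^ (K - n)) ^ 3 / (am * c₁))) ^ 2 * Real.sqrt ((25 / 8) * (c₁ * ((((F.P K).L : ℝ) ^ (F.P K).d) ^ (K - n))⁻¹ / c₀))) + (2 * Real.sqrt ((25 / 8) * (c₁ * ((((F.P K).L : ℝ) ^ (F.P K).d) ^ (K - n))⁻¹ / c₀))) * (Real.exp (-(μa * ((Bt - 1) / ν))) * (8 * Real.sqrt (max 2 (16 * c₀ * ((F.L : ℝ) ^ (K - n)) ^ 3 / (am * c₁))) ^ 2) ^ 2 * Real.sqrt ((25 / 8) * (c₁ * ((((F.P K).L : ℝ) ^ (F.P K).d) ^ (K - n))⁻¹ / c₀))) + Real.sqrt ((25 / 8) * (c₁ * ((((F.P K).L : ℝ) ^ (F.P K).d) ^ (K - n))⁻¹ / c₀)) * ((Real.sqrt (max 2 (16 * c₀ *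 ((F.L : ℝ) ^ (K - n)) ^ 3 / (am * c₁)))⁻¹⁻¹ * (1 + Real.sqrt (max 2 (16 * c₀ * ((F.L : ℝ) ^ (K - n)) ^ 3 / (am * c₁)))⁻¹⁻¹) * ((Real.sqrt 3 * (eta F n K)⁻¹ * (ν * eta F n K) + Real.sqrt 24 * (2 * ε₀ * ((Rb : ℝ) + 7)) + 2 * (Real.sqrt 3 * (eta F n K)⁻¹ * (ν * eta F n K)) * (Real.sqrt 24 * (2 * ε₀ * ((Rb : ℝ) + 7)))) * Real.sqrt (max 2 (16 * c₀ * ((F.L : ℝ) ^ (K - n)) ^ 3 / (am * c₁)))⁻¹⁻¹ + ((Real.sqrt 3 * (eta F n K)⁻¹ * (ν * eta F n K) + Real.sqrt 24 * (2 * ε₀ * ((Rb : ℝ) + 7)) + 2 * (Real.sqrt 3 * (eta F n K)⁻¹ * (ν * eta F n K)) * (Real.sqrt 24 * (2 * ε₀ * ((Rb : ℝ) + 7)))) + am * ((25 / 4) * (c₁ * ((((F.P K).L : ℝ) ^ (F.P K).d) ^ (K - n))⁻¹ / c₀) * (3 * ν) + 2 * Real.sqrt ((25 / 8) * (c₁ *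 ((((F.P K).L : ℝ) ^ (F.P K).d) ^ (K - n))⁻¹ / c₀)) * (Real.sqrt (2 * (c₁ * ((((F.P K).L : ℝ) ^ (F.P K).d) ^ (K - n))⁻¹ / c₀)) * (2 * (4500 * (F.L : ℝ) ^ 2 * ε₀) + 2 * 0 + 2 * (48 * ε₀ * ((Rb : ℝ) + 9)))))) * (max 2 (16 * c₀ * ((F.L : ℝ) ^ (K - n)) ^ 3 / (am * c₁)))⁻¹⁻¹) + Real.sqrt (max 2 (16 * c₀ * ((F.L : ℝ) ^ (K - n)) ^ 3 / (am * c₁)))⁻¹⁻¹ * (1 + Real.sqrt (max 2 (16 * c₀ * ((F.L : ℝ) ^ (K - n)) ^ 3 / (am * c₁)))⁻¹⁻¹) * ((Real.sqrt 3 * (eta F n K)⁻¹ * (ν * eta F n K) + Real.sqrt 24 * (2 * ε₀ * ((Rb : ℝ) + 7)) + 2 * (Real.sqrt 3 * (eta F n K)⁻¹ * (ν * eta F n K)) * (Real.sqrt 24 * (2 * ε₀ * ((Rb : ℝ) + 7)))) * Real.sqrt (max 2 (16 * c₀ * ((F.L : ℝ) ^ (K - n)) ^ 3 / (am * c₁)))⁻¹⁻¹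 + ((Real.sqrt 3 * (eta F n K)⁻¹ * (ν * eta F n K) + Real.sqrt 24 * (2 * ε₀ * ((Rb : ℝ) + 7)) + 2 * (Real.sqrt 3 * (eta F n K)⁻¹ * (ν * eta F n K)) * (Real.sqrt 24 * (2 * ε₀ * ((Rb : ℝ) + 7)))) + am * ((25 / 4) * (c₁ * ((((F.P K).L : ℝ) ^ (F.P K).d) ^ (K - n))⁻¹ / c₀) * (3 * ν) + 2 * Real.sqrt ((25 / 8) * (c₁ * ((((F.P K).L : ℝ) ^ (F.P K).d) ^ (K - n))⁻¹ / c₀)) * 0)) * (max 2 (16 * c₀ * ((F.L : ℝ) ^ (K - n)) ^ 3 / (am * c₁)))⁻¹⁻¹)) * ((max 2 (16 * c₀ * ((F.L : ℝ) ^ (K - n)) ^ 3 / (am * c₁))) * Real.sqrt ((25 / 8) * (c₁ * ((((F.P K).L : ℝ) ^ (F.P K).d) ^ (K - n))⁻¹ / c₀)))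
          + 2 * (max 2 (16 * c₀ * ((F.L : ℝ) ^ (K - n)) ^ 3 / (am * c₁))) * (Real.exp (-(μa * ((Bt - 1) / ν))) * (8 * Real.sqrt (max 2 (16 * c₀ * ((F.L : ℝ) ^ (K - n)) ^ 3 / (am * c₁))) ^ 2) * Real.sqrt ((25 / 8) * (c₁ * ((((F.P K).L : ℝ) ^ (F.P K).d) ^ (K - n))⁻¹ / c₀))) + (max 2 (16 * c₀ * ((F.L : ℝ) ^ (K - n)) ^ 3 / (am * c₁))) * ((Real.sqrt (max 2 (16 * c₀ * ((F.L : ℝ) ^ (K - n)) ^ 3 / (am * c₁)))⁻¹⁻¹ * (1 + Real.sqrt (max 2 (16 * c₀ * ((F.L : ℝ) ^ (K - n)) ^ 3 / (am * c₁)))⁻¹⁻¹) * ((Real.sqrt 3 * (eta F n K)⁻¹ * (ν * eta F n K) + Real.sqrt 24 * (2 * ε₀ * ((Rb : ℝ) + 7)) + 2 * (Real.sqrt 3 * (eta F n K)⁻¹ * (ν * eta F n K)) * (Real.sqrt 24 * (2 * ε₀ * ((Rb : ℝ) + 7)))) * Real.sqrt (max 2 (16 * c₀ * ((F.L : ℝ)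 ^ (K - n)) ^ 3 / (am * c₁)))⁻¹⁻¹ + ((Real.sqrt 3 * (eta F n K)⁻¹ * (ν * eta F n K) + Real.sqrt 24 * (2 * ε₀ * ((Rb : ℝ) + 7)) + 2 * (Real.sqrt 3 * (eta F n K)⁻¹ * (ν * eta F n K)) * (Real.sqrt 24 * (2 * ε₀ * ((Rb : ℝ) + 7)))) + am * ((25 / 4) * (c₁ * ((((F.P K).L : ℝ) ^ (F.P K).d) ^ (K - n))⁻¹ / c₀) * (3 * ν) + 2 * Real.sqrt ((25 / 8) * (c₁ * ((((F.P K).L : ℝ) ^ (F.P K).d) ^ (K - n))⁻¹ / c₀)) * (Real.sqrt (2 * (c₁ * ((((F.P K).L : ℝ) ^ (F.P K).d) ^ (K - n))⁻¹ / c₀)) * (2 * (4500 * (F.L : ℝ) ^ 2 * ε₀) + 2 * 0 + 2 * (48 * ε₀ * ((Rb : ℝ) + 9)))))) * (max 2 (16 * c₀ * ((F.L : ℝ) ^ (K - n)) ^ 3 / (am * c₁)))⁻¹⁻¹) + Real.sqrt (max 2 (16 * c₀ * ((F.L : ℝ) ^ (K - n)) ^ 3 / (am * c₁)))⁻¹⁻¹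 * (1 + Real.sqrt (max 2 (16 * c₀ * ((F.L : ℝ) ^ (K - n)) ^ 3 / (am * c₁)))⁻¹⁻¹) * ((Real.sqrt 3 * (eta F n K)⁻¹ * (ν * eta F n K) + Real.sqrt 24 * (2 * ε₀ * ((Rb : ℝ) + 7)) + 2 * (Real.sqrt 3 * (eta F n K)⁻¹ * (ν * eta F n K)) * (Real.sqrt 24 * (2 * ε₀ * ((Rb : ℝ) + 7)))) * Real.sqrt (max 2 (16 * c₀ * ((F.L : ℝ) ^ (K - n)) ^ 3 / (am * c₁)))⁻¹⁻¹ + ((Real.sqrt 3 * (eta F n K)⁻¹ * (ν * eta F n K) + Real.sqrt 24 * (2 * ε₀ * ((Rb : ℝ) + 7)) + 2 * (Real.sqrt 3 * (eta F n K)⁻¹ * (ν * eta F n K)) * (Real.sqrt 24 * (2 * ε₀ * ((Rb : ℝ) + 7)))) + am * ((25 / 4) * (c₁ * ((((F.P K).L : ℝ) ^ (F.P K).d) ^ (K - n))⁻¹ / c₀) * (3 * ν) + 2 * Real.sqrt ((25 / 8) * (c₁ * ((((F.P K).L : ℝ) ^ (F.P K).d) ^ (K - n))⁻¹ / c₀))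 * 0)) * (max 2 (16 * c₀ * ((F.L : ℝ) ^ (K - n)) ^ 3 / (am * c₁)))⁻¹⁻¹)) * Real.sqrt ((25 / 8) * (c₁ * ((((F.P K).L : ℝ) ^ (F.P K).d) ^ (K - n))⁻¹ / c₀)))
          + (max 2 (16 * c₀ * ((F.L : ℝ) ^ (K - n)) ^ 3 / (am * c₁))) ^ 2 * (Real.sqrt (2 * (c₁ * ((((F.P K).L : ℝ) ^ (F.P K).d) ^ (K - n))⁻¹ / c₀)) * (2 * (4500 * (F.L : ℝ) ^ 2 * ε₀) + 2 * 0 + 2 * (48 * ε₀ * ((Rb : ℝ) + 9))))))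
      ≤ εN)
    (hbG : cG ≤ δP / (8 * Real.sqrt (25 / 8) * (((2 / ((1 + 25 / 8) * (600 * (27 / 4 : ℝ) ^ 6 + am))) ^ 2)⁻¹ * (Real.sqrt (25 / 8) * (max 2 (16 / am))))))
    (hbQ : cQ ≤ δP / (8 * (((2 / ((1 + 25 / 8) * (600 * (27 / 4 : ℝ) ^ 6 + am))) ^ 2)⁻¹ * (Real.sqrt (25 / 8) * (max 2 (16 / am))))))
    (hbN : εN ≤ δP / (4 * ((Real.sqrt (25 / 8) * (max 2 (16 / am))) * (((2 / ((1 + 25 / 8) * (600 * (27 / 4 : ℝ) ^ 6 + am))) ^ 2)⁻¹ * (((2 / ((1 + 25 / 8) * (600 * (27 / 4 : ℝ) ^ 6 + am))) ^ 2)⁻¹ * (Real.sqrt (25 / 8) * (max 2 (16 / am))))))))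
    (hbr : 2 / (min ((1 / (10 * Real.sqrt (max 2 (16 / am)) * Real.sqrt (27 + 2025 / 8 * am))) / 2) ((2 / ((1 + 25 / 8) * (600 * (27 / 4 : ℝ) ^ 6 + am))) / (3 * ((Real.sqrt (max 2 (16 / am)) * (2 + Real.sqrt (max 2 (16 / am))) * (3 * Real.sqrt 3 + 27 + 9 * Real.sqrt am * Real.sqrt (25 / 8) + 81 * am * (25 / 8))
          * (8 * Real.sqrt (max 2 (16 / am)) + 8 * Real.sqrt (max 2 (16 / am)) ^ 2) * (10 * Real.sqrt (25 / 8)) + 9 * (max 2 (16 / am)) * Real.sqrt (25 / 8)))))) * Real.log (4 * ((Real.sqrt (25 / 8) * (max 2 (16 / am))) * (((2 / ((1 + 25 / 8) * (600 * (27 / 4 : ℝ) ^ 6 + am))) ^ 2)⁻¹ * ((Real.sqrt (25 / 8) * (max 2 (16 / am)) ^ 2 * Real.sqrt (25 / 8) + Real.sqrt (25 / 8) * (max 2 (16 / am)) ^ 2 * Real.sqrt (25 / 8)) * ((18 / (2 / ((1 + 25 / 8) * (600 * (27 / 4 : ℝ) ^ 6 + am))) ^ 2) * (24 * (max 2 (16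 / am)) * Real.sqrt (25 / 8)) * (4 * (2 * (1 + 2 / (1 / (10 * Real.sqrt (max 2 (16 / am)) * Real.sqrt (27 + 2025 / 8 * am))))) ^ 3) * Real.sqrt ((2 * (1 + 2 * (2 / (1 / (10 * Real.sqrt (max 2 (16 / am)) * Real.sqrt (27 + 2025 / 8 * am))) + 3 * ((Real.sqrt (max 2 (16 / am)) * (2 + Real.sqrt (max 2 (16 / am))) * (3 * Real.sqrt 3 + 27 + 9 * Real.sqrt am * Real.sqrt (25 / 8) + 81 * am * (25 / 8))
          * (8 * Real.sqrt (max 2 (16 / am)) + 8 * Real.sqrt (max 2 (16 / am)) ^ 2) * (10 * Real.sqrt (25 / 8)) + 9 * (max 2 (16 / am)) * Real.sqrt (25 / 8))) / (2 / ((1 + 25 / 8) * (600 * (27 / 4 : ℝ) ^ 6 + am)))))) ^ 3 * (4 * (2 * (1 + 2 * (2 / (1 / (10 * Real.sqrt (max 2 (16 / am)) * Real.sqrt (27 + 2025 / 8 * am))) + 3 * ((Real.sqrt (max 2 (16 / am)) * (2 + Real.sqrt (max 2 (16 / am))) * (3 * Real.sqrt 3 + 27 + 9 * Real.sqrt am *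 Real.sqrt (25 / 8) + 81 * am * (25 / 8))
          * (8 * Real.sqrt (max 2 (16 / am)) + 8 * Real.sqrt (max 2 (16 / am)) ^ 2) * (10 * Real.sqrt (25 / 8)) + 9 * (max 2 (16 / am)) * Real.sqrt (25 / 8))) / (2 / ((1 + 25 / 8) * (600 * (27 / 4 : ℝ) ^ 6 + am)))))) ^ 3)))))) / δP) ≤ r) :
    ∀ A : BondL2K ℂ 3 (periodsT3 F K) c₀ W₂,
      (((1 - (3 * θc + δP)) * (1 / (4 * B5Prop11Plancherel.Cst 3 a₀)) - ((1 + θc⁻¹) * (160 * ε₀ ^ 2 * (3 * (F.L : ℝ) ^ s + 7) ^ 2) + (1 + θc) * (1029 * ε₀) + a₀ * ((1 + θc⁻¹) * (4 * (3 * 10 ^ 10 * (F.L : ℝ) ^ 10 * ε₀ ^ 2 + 768 * ε₀ ^ 2 * (3 * (F.L : ℝ) ^ s + 7) ^ 2))) + (2 * θc + δP) * ((2 / ((1 + 25 / 8) * (600 * (27 / 4 : ℝ) ^ 6 + am))) ^ 2 * am)⁻¹)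
        - ((1 + θ⁻¹) * (11520 * (((F.L : ℝ) ^ s) ^ 2)⁻¹) + (2 + θ) * (1029 * ε₀))
        - ((1 + θ⁻¹) * ((17280 * (((F.L : ℝ) ^ s) ^ 2)⁻¹ + 2 * κP ^ 2 * (((2 / ((1 + 25 / 8) * (600 * (27 / 4 : ℝ) ^ 6 + am))) ^ 2 * am)⁻¹ + 1029 * ε₀)) + 12441600 * a₀ * (((F.L : ℝ) ^ s) ^ 2)⁻¹)))
       / (1 + θ + (1 + θ⁻¹) * (2 * κP ^ 2))) * ‖A‖ ^ 2
        ≤ (RCLike.re ⟪A, DeltaEta F n K c₀ U₀ A⟫_ℂ + ‖projR (covLapSite F n K c₀ U₀) QU (DstarL2 F n K c₀ U₀ A)‖ ^ 2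
        + (a₀ * (c₀ / cB) * ((F.L : ℝ) ^ (K - n)) ^ 3) * ‖Qk F n K h c₀ cB U₀ A‖ ^ 2) := by
  have hc₀ : 0 < c₀ := Fact.out
  have hL1 : (1 : ℝ) < F.L := by exact_mod_cast F.hL.2
  have hL0 : (0 : ℝ) < F.L := lt_trans zero_lt_one hL1
  have hε7 : 10 ^ 7 * (F.L : ℝ) ^ 3 * ε₀ ≤ 1 := by
    have h0 : 0 ≤ (F.L : ℝ) ^ 3 * ε₀ := by positivity
    have h1 : (10 : ℝ) ^ 7 * ((F.L : ℝ) ^ 3 * ε₀) ≤ 10 ^ 12 * ((F.L : ℝ) ^ 3 * ε₀) := mul_le_mul_of_nonneg_right (by norm_num) h0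
    have h2 : (10 : ℝ) ^ 12 * ((F.L : ℝ) ^ 3 * ε₀) = 10 ^ 12 * (F.L : ℝ) ^ 3 * ε₀ := by ring
    have h3 : (10 : ℝ) ^ 7 * ((F.L : ℝ) ^ 3 * ε₀) = 10 ^ 7 * (F.L : ℝ) ^ 3 * ε₀ := by ring
    linarith only [h1, h2, h3, hε12]
  have hwrap := hwrap_of_room F (K := K) hnK.le hs1 hroom
  have hwrapRb := hwrapRb_of_room F (K := K) hnK.le Rb hroomRb
  have hseq₁ := hseq_of_htop F c₀ (1 : GaugeField (F.P K) 0 (Matrix.specialUnitaryGroup (Fin 2) ℂ)) Q1 htop₁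
  -- the massive families OF RECORD over the coarse space of weight `c₁` (§1)
  obtain ⟨ι, hι, Qc, hseqc, Tc, hTc, Gc, hAGc, hGAc, T1, hT1, G1, hAG1, hGA1⟩ :=
    exists_cube_families F h c₀ c₁ hε₀ hε7 hε12 U₀ hreg ham Q1 hseq₁
  -- ★p1's pin `c₁ = c₀·(L³)^(K−n)` makes the slot-K2 letters numeric (routeR-w4 g27's computation, copied)
  have hsx : (25 / 8) * (c₁ * ((((F.P K).L : ℝ) ^ (F.P K).d) ^ (K - n))⁻¹ / c₀) = 25 / 8 := by
    rw [hc₁, show ((F.P K).L : ℝ) = (F.L : ℝ) from rfl, T3Family.P_d]; field_simp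
  have hMraw : 16 * c₀ * ((F.L : ℝ) ^ (K - n)) ^ 3 / (am * c₁) = 16 / am := by
    rw [hc₁, ← pow_mul, ← pow_mul, Nat.mul_comm]; field_simp
  have hM : max 2 (16 * c₀ * ((F.L : ℝ) ^ (K - n)) ^ 3 / (am * c₁)) = max 2 (16 / am) := by rw [hMraw]
  have hη : 0 < eta F n K := eta_pos F n K
  have hη1 : eta F n K ≤ 1 := by
    show ((F.L : ℝ)⁻¹) ^ (K - n) ≤ 1
    exact pow_le_one₀ (inv_nonneg.2 hL0.le) (inv_le_one_of_one_le₀ hL1.le)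
  -- the OP∕RB2 window at slope `μa` (routeR-w4 g27's ✓`window_delta`; the win row is the displayed `hwinμ`)
  have hδw := Prop7LODSlotK2WindowLetters.window_delta (a := am) (sx := ((25 / 8) * (c₁ * ((((F.P K).L : ℝ) ^ (F.P K).d) ^ (K - n))⁻¹ / c₀))) (η := eta F n K)
    ham hsx hη hη1 hμa hμa3
  have hwin : Real.sqrt (max 2 (16 * c₀ * ((F.L : ℝ) ^ (K - n)) ^ 3 / (am * c₁))) * (Real.sqrt (27 + 2025 / 8 * am) * μa) ≤ 1 / 10 := by
    rw [hM]; exact hwinμ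
  have hδ₁ : (0 : ℝ) ≤ Real.sqrt (27 + 2025 / 8 * am) * μa := by positivity
  -- routeR-w3 g13's three rows at the families of record, weakened to the letters `cG cQ εN` (D1)
  have hRB1 := hRB1_of_cube_le F h hε₀ hε7 U₀ hreg ι hι ham s hr Qc hseqc Tc hTc Gc hAGc hGAc Q1 hseq₁ T1 hT1 G1 hAG1 hGA1 hν hμa hBt hBc Rb hRb hwrapRb hεRb hG
  have hRB2 := hRB2_of_cube_le F h hε₀ hε7 U₀ hreg ι hι ham s hr Qc hseqc Q1 hseq₁ T1 hT1 G1 hAG1 hν hμa hBt hBc Rb hRb hwrapRb hεRb hδ₁ hδw hwin hQ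
  have hop := hop_of_cube_le F h hε₀ hε7 U₀ hreg ι hι ham s hr Qc hseqc Tc hTc Gc hAGc hGAc Q1 hseq₁ T1 hT1 G1 hAG1 hGA1 hν hμa hBt hBc Rb hRb hwrapRb hεRb hδ₁ hδw hwin hN
  -- routeR-w4 g27's budget lemma: `δPmax(am, cG, cQ, εN, r) ≤ δP` from the four quarter-budgets
  have hδPmax := Prop7LocalProjectorRowCubeWindow.deltaPmax_le_of_budget ham hδP hbG hbQ hbN hbr
  exact curvedTarget_member_of_cubeRows F h c₀ cB hε₀ hε hε12 U₀ hreg s hnK hs hwrap ha₀ QU htop Q1 htop₁ hker₁ hθ hθc hδP.le hsmall ham hκP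
    hc₁ ι hι r Qc hseqc Tc hTc Gc hAGc hGAc T1 hT1 G1 hAG1 hGA1 hcG hcQ hεN hop hRB1 hRB2 hδPmax

end Summit.QuantumFields.YangMills.Theorems.Prop7LODTargetClosed

end
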